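import Mathlib
import Literature.Geometry.DiscreteGeometry.KissingContactMaximum
import Literature.MathematicalPhysics.StatisticalMechanics.FlatleyTheil2015NeighbourCounting
import Literature.MathematicalPhysics.StatisticalMechanics.FlatleyTheil2015Crystallization
import HarnessLib

/-!
# Flatley–Theil 2015, Proposition 3.3.1, second clause: `½ #𝒜(x) ≤ 24` for `α < α₀`
(the perturbed 24-contact bound) — proof, modulo Theorem 3.5

Topic `Literature/MathematicalPhysics/StatisticalMechanics`; companion of
`FlatleyTheil2015NeighbourCounting.lean` (which proves the FIRST clause `#N(x) ≤ 12` of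
Proposition 3.3.1 by the same compactness method from the kissing number theorem) and of
`Literature/Geometry/DiscreteGeometry/KissingContactMaximum.lean` (the named fact
`FlatleyEtAl2013_maxContacts` = Flatley–Tarasov–Taylor–Theil 2013, Theorem 4 = Flatley–Theil 2015,
Theorem 3.5: twelve kissing balls touch each other at most `24` times; computer-assisted in print,
undischarged in the tree), whose docstring records: "Not here: the robust form (Flatley–Theil
2015, Prop. 3.3: `α`-bonds, by compactness, no rate)". This file proves that robust form, with
Theorem 3.5 as the hypothesis `(h35 : FlatleyEtAl2013_maxContacts)` — exactly the input of the
printed proof — and nothing else. Source: L. Flatley, F. Theil, *Face-centered cubic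
crystallization of atomistic configurations*, Arch. Ration. Mech. Anal. **218** (2015) 363–416 =
arXiv:1407.0692 [cite: FlatleyTheil2015], read in the held arXiv text (lit store
`paper:arxiv-1407.0692`, p. 9).

## Source, as printed

§2 (2.5) [(eq:S)]: "`𝒩 := {(x, x') ∈ X × X : ||y(x') − y(x)| − 1| ≤ α}`" (ORDERED pairs); §3.1.2:
"`N(x) := {x' ∈ X : (x, x') ∈ 𝒩}`", "`𝒜(x) := {q ∈ 𝒩 : q ⊂ N(x)}`, … the set of edges contained
within the nearest neighborhood of `x`"; Proposition 2.6's display (eq:mindist):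
"`min_{x ≠ x'} |y(x') − y(x)| > 1 − α`".

> **Proposition 3.3** (Local neighborhoods). There exists a constant `α₀ > 0` such that for all
> `α ∈ (0, α₀)` and and all configurations `y : X → ℝ³` satisfying the minimum distance bound
> (eq:mindist) the following statements are true.
> 1. `#N(x) ≤ 12` and `½ #𝒜(x) ≤ 24` for all `x ∈ X`.
> 2. [the local fcc/hcp rigidity clause, not formalized here]
>
> … The proof of Proposition 3.3 depends on two key results: the three-dimensional kissing
> problem (Theorem 3.4) and the maximum number of tangencies in a kissing configuration of unit
> spheres (Theorem 3.5). … *Proof.* The proof of statements 1 and 2 is an immediate consequence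
> of Theorems 3.4 & 3.5 and standard compactness arguments. □

## What is proved, and how ("standard compactness arguments" made explicit)

* `FlatleyTheil2015.contactPattern_false` — the exact (`α = 0`) content of `h35` in indexed form:
  `k` unit vectors with pairwise distances `≥ 1` cannot realise `≥ 49` ORDERED unit contacts
  (`= 24½` unordered) on a prescribed set `E` of index pairs.
* `FlatleyTheil2015.exists_card_contactPairs_le_annulus` — **the perturbed 24-contact bound**
  (geometric form): there is `α₀ > 0` such that for all `α < α₀`, every finite set `T` of points of
  the annulus `1 − α ≤ |v| ≤ 1 + α` with pairwise distances `≥ 1 − α` has at most `48` ordered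
  pairs `(v, w)`, `v ≠ w`, with `|v − w| ≤ 1 + α`. Proof: by the first clause
  (`exists_card_le_twelve_annulus` of the companion file) `#T ≤ 12`; for each of the finitely
  many contact patterns `E` on `k ≤ 12` indices with `#E ≥ 49` the continuous penalty
  `Φ_E(p) = Σᵢ |‖pᵢ‖ − 1| + Σ_{i ≠ j} (1 − ‖pᵢ − pⱼ‖)⁺ + Σ_{(i,j) ∈ E} (‖pᵢ − pⱼ‖ − 1)⁺` is
  positive on the compact box `‖p‖_∞ ≤ 2` (a zero would be an exact configuration, excluded by
  `contactPattern_false`), hence `≥ m_E > 0` there, while the `α`-hypotheses give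
  `Φ_E(p) ≤ (k + k² + #E) α`; `α₀` is the minimum over the patterns (a `Finset.inf'` over a finite
  index type), capped by the first clause's constant.
* `FlatleyTheil2015.exists_card_nbhdPairs_le` — **Proposition 3.3.1, second clause, AS PRINTED**
  (modulo `h35`): there is `α₀ > 0` such that for all `α < α₀` (so for all `α ∈ (0, α₀)`), every
  finite label set `X`, every `y : X → ℝ³` with (eq:mindist) and every `x ∈ X`:
  `#𝒜(x) ≤ 48`, i.e. `½ #𝒜(x) ≤ 24`, where `𝒜(x)` = the ordered pairs `(x₁, x₂) ∈ N(x) × N(x)`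
  with `(x₁, x₂) ∈ 𝒩`. The constant is uniform in `X`, `y`, `x`, as printed.

* (v2) `FlatleyTheil2015.exists_card_eq_twelve_of_contactPairs_annulus` /
  `exists_card_nbhd_eq_twelve_of_pairs` — **Proposition 3.3.2, first assertion** ("If
  `½ #𝒜(x) = 24`, then `#N(x) = 12`"), modulo `h35`: for `α < α₀`, `#𝒜(x) ≥ 48` forces
  `#N(x) = 12` (same compactness, the exact case being `FlatleyEtAl2013_maxContacts.card_eq_twelve`:
  an arrangement with `24` contacts has twelve balls; `contactPattern_false_of_le_eleven`).
* (v2) `FlatleyTheil2015.exists_threeBody_lowerBound` — **the three-body local bound (tbound) of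
  §6** (arXiv p. 17: "Proposition 3.3.1 implies that `e₃(x) ≥ 48 Ψ(1,1,1)` if `x ∈ X_reg`,
  `46 Ψ(1,1,1)` else"), modulo `h35`, for every `Ψ` in the tree's transcription
  `IsLocalizedTriple α Ψ` of Definition 2.1 item 2: `48 Ψ(1,1,1) ≤ e₃(x)` always and
  `46 Ψ(1,1,1) ≤ e₃(x)` when `#𝒜(x) ≠ 48`, where `e₃(x) = Σ_{x₁ ≠ x} Σ_{x₂ ≠ x, x₁}
  Ψ(sideLengths (y x) (y x₁) (y x₂))` (ordered double sum = `2 Σ` over unordered pairs, as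
  printed). Mechanism (the printed "since `Ψ = 0` if `max rᵢ ≥ 1 + α`" corrected to what Definition
  2.1 gives): the `#𝒜(x) ≤ 48` triples with all three sides `α`-close to `1` contribute `≥ Ψ(1,1,1)
  = −1` each (the minimum of `Ψ`), all other triples have a side `α`-far from `1` and contribute
  `≥ 0`; `#𝒜(x)` is even (swap symmetry), so `#𝒜(x) ≠ 48` means `≤ 46`.

* (v3) `FlatleyTheil2015.exists_close_pattern_of_contactPairs` / `exists_localChart` —
  **Proposition 3.3.2, the local chart**, modulo `h35`, in `δ`-form (for every `δ > 0` there is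
  `α₀(δ) > 0` …; this is the content of the printed "monotone `ε` with `lim_{α→0} ε(α) = 0`"):
  for `α < α₀(δ)` and `#𝒜(x) ≥ 48`, `#N(x) = 12` and there are `Q ∈ {Cub, TCub}`, a linear isometry
  `R` and `Φ : ℝ³ → X` with `Φ(0) = x`, `Φ(Q) ⊆ N(x)`, `Φ` injective on `Q ∪ {0}`,
  `(Φ η, Φ η′) ∈ 𝒩 ↔ |η − η′| = 1` on `Q ∪ {0}`, and `|R η + y(x) − y(Φ η)| < δ` on `Q ∪ {0}`.
  Compactness with closeness (`exists_alpha_close`): the exact configurations with a given contact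
  pattern form the compact zero set `G` of the penalty functional; on the box points at
  `infDist ≥ δ` from `G` the functional has a positive minimum; the exact configuration found is a
  (twisted) cuboctahedron by the equality clause of `h35`, and its contact set is exactly the
  realised pattern because `h35` caps the contacts at `48`.

* (v4) `FlatleyTheil2015.exists_localChart_detOne` — the same with `R` of determinant `1`
  (`SO(3)`, as printed): both patterns have an orientation-reversing linear symmetry
  (`exists_detNegOne_symmetry`: `−id` for `Cub`, `neg_mem_fccKissingPattern`; the mirror in the
  hexagonal mid-plane `(1,1,1)^⊥` for `TCub`, `exists_mirror_hcpKissingPattern`, via Mathlib's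
  `Submodule.reflection` / `Submodule.det_reflection` and the integer model `hcpInt`), with which
  `R` and `Φ` are precomposed when `det R = −1`. This also proves the remark of
  `KissingContactMaximum.lean` that `O(3)`- and `SO(3)`-orbits of the two patterns agree.

* (v5) `FlatleyTheil2015.exists_shellCloseTo_of_softContacts` — Proposition 3.3.2 (modulo `h35`)
  restated in the `ShellCloseTo` / `Nat.card` vocabulary of `KissingPatterns.lean` used by the
  routes TwoCentreKissing / SoftAnnulusKernel: for every `δ > 0` there is `η₀ > 0` such that for
  `η < η₀` a finite `T ⊂ ℝ³` with norms in `[1 − η, 1 + η]`, pairwise distances `≥ 1 − η` and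
  `≥ 48` ordered soft contacts satisfies `ShellCloseTo δ T Cub ∨ ShellCloseTo δ T TCub`.
  INEFFECTIVE `η₀(δ)` only (compactness, as printed); the routes' numerical `η ≤ 1/1000`,
  `δ = 1/10` (`RobustTangencyBound`) are NOT obtained here.

* (v6) **Definition 3.6** — the label classes `labelsTwelve` (`X₁₂`), `labelsReg` (`X_reg`),
  `labelsCub` (`X_Cub`), `labelsTcub` (`X_TCub`), `labelsBoundary` (`∂X = X ∖ X_Cub`), the chart
  predicate `HasLocalChart` ((eq:qdist), `δ`-form, `R ∈ SO(3)`) — and **the partition display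
  following it (p. 10)**: `exists_labelsReg_eq_union` (`X_reg = X_Cub ∪ X_TCub`,
  `X_Cub ∩ X_TCub = ∅` for `α < α₀(δ)`, modulo `h35`) with the disjointness
  `disjoint_labelsCub_labelsTcub` / `not_hasLocalChart_fcc_hcp` UNCONDITIONAL (all `α`, `δ`; no
  `h35`): the contact graphs of `Cub` and `TCub` are not isomorphic (every unit edge of `Cub` has
  exactly one common unit neighbour; `TCub` has unit edges with two).

Not here: an explicit monotone modulus `ε(α)` (the printed packaging; equivalent to the `δ`-form);
the `α = 0` theorem itself (`FlatleyEtAl2013_maxContacts`, computer-assisted). No named fact; the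
only definitions are the private integer helpers `mirrorInt`, `hexNormal` and (v6) the label
classes of Definition 3.6 with the chart predicate `HasLocalChart`, all with bodies (D-0026).
-/

noncomputable section

open Finset
open scoped BigOperators
open Literature.Geometry.DiscreteGeometry (FlatleyEtAl2013_maxContacts)

namespace Literature.MathematicalPhysics.StatisticalMechanics

namespace FlatleyTheil2015

section PerturbedContacts


/-- **The exact case in indexed form.** `k` unit vectors of `ℝ³` with pairwise distances `≥ 1`
cannot have `≥ 49` ordered unit contacts on a prescribed set `E` of index pairs `(i, j)`,
`i ≠ j` (`‖pᵢ − pⱼ‖ ≤ 1`, hence `= 1`): the image is a kissing arrangement with `> 48` ordered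
contact pairs, against Theorem 3.5 (`h35`).
[cite: FlatleyTheil2015, Theorem 3.5 (via the named fact `FlatleyEtAl2013_maxContacts`)] -/
theorem contactPattern_false (h35 : FlatleyEtAl2013_maxContacts) {k : ℕ}
    (p : Fin k → EuclideanSpace ℝ (Fin 3))
    (h1 : ∀ i, ‖p i‖ = 1) (h2 : ∀ i j, i ≠ j → 1 ≤ ‖p i - p j‖) {E : Finset (Fin k × Fin k)}
    (hE : ∀ q ∈ E, q.1 ≠ q.2) (hE1 : ∀ q ∈ E, ‖p q.1 - p q.2‖ ≤ 1) (hcard : 49 ≤ E.card) :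
    False := by
  classical
  have hinj : Function.Injective p := by
    intro i j hij
    by_contra hne
    have h := h2 i j hne
    rw [hij, sub_self, norm_zero] at h
    linarith
  set Z : Finset (EuclideanSpace ℝ (Fin 3)) := univ.image p with hZ
  have hn : ∀ v ∈ Z, ‖v‖ = 1 := by
    intro v hv
    obtain ⟨i, -, rfl⟩ := mem_image.1 hv
    exact h1 i
  have hsep : ∀ v ∈ Z, ∀ w ∈ Z, v ≠ w → 1 ≤ dist v w := by
    intro v hv w hw hvw
    obtain ⟨i, -, rfl⟩ := mem_image.1 hv
    obtain ⟨j, -, rfl⟩ := mem_image.1 hw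
    rw [dist_eq_norm]
    exact h2 i j fun e => hvw (by rw [e])
  have h48 := (h35 Z hn hsep).1
  have hle : E.card ≤ ((Z ×ˢ Z).filter
      fun q : EuclideanSpace ℝ (Fin 3) × EuclideanSpace ℝ (Fin 3) => dist q.1 q.2 = 1).card := by
    refine Finset.card_le_card_of_injOn (fun q => (p q.1, p q.2)) ?_ ?_
    · intro q hq
      simp only [coe_filter, mem_product, Set.mem_setOf_eq, hZ, mem_image, mem_univ, true_and,
        exists_apply_eq_apply, and_self]
      rw [dist_eq_norm]
      exact le_antisymm (hE1 q hq) (h2 _ _ (hE q hq))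
    · intro q _ q' _ hqq'
      simp only [Prod.mk.injEq] at hqq'
      exact Prod.ext (hinj hqq'.1) (hinj hqq'.2)
  omega

/-- The penalty functional of the compactness argument for a contact pattern `E` on `k` indices,
`Φ_E(p) = Σᵢ |‖pᵢ‖ − 1| + Σ_{i ≠ j} max 0 (1 − ‖pᵢ − pⱼ‖) + Σ_{(i,j) ∈ E} max 0 (‖pᵢ − pⱼ‖ − 1)`,
packaged by its three properties: continuity; `Φ_E(p) ≤ (k + k² + #E) α` for points of the
`α`-annulus pairwise `≥ 1 − α` apart whose `E`-pairs are `(1 + α)`-contacts (`α ≥ 0`);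
`Φ_E(p) ≤ 0` forces the exact configuration. [folklore] -/
private theorem exists_contact_functional (k : ℕ) (E : Finset (Fin k × Fin k)) :
    ∃ Φ : (Fin k → EuclideanSpace ℝ (Fin 3)) → ℝ, Continuous Φ ∧
      (∀ p (α : ℝ), 0 ≤ α → (∀ i, |‖p i‖ - 1| ≤ α) → (∀ i j, i ≠ j → 1 - α ≤ ‖p i - p j‖) →
        (∀ q ∈ E, ‖p q.1 - p q.2‖ ≤ 1 + α) → Φ p ≤ ((k + k * k + E.card : ℕ) : ℝ) * α) ∧
      (∀ p, Φ p ≤ 0 → (∀ i, ‖p i‖ = 1) ∧ (∀ i j, i ≠ j → 1 ≤ ‖p i - p j‖) ∧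
        ∀ q ∈ E, ‖p q.1 - p q.2‖ ≤ 1) := by
  classical
  refine ⟨fun p => (∑ i, |‖p i‖ - 1|) +
      (∑ q ∈ (univ : Finset (Fin k)).offDiag, max 0 (1 - ‖p q.1 - p q.2‖)) +
      ∑ q ∈ E, max 0 (‖p q.1 - p q.2‖ - 1), ?_, ?_, ?_⟩
  · refine ((continuous_finsetSum _ fun i _ => ?_).add
      (continuous_finsetSum _ fun q _ => ?_)).add (continuous_finsetSum _ fun q _ => ?_)
    · exact ((continuous_apply i).norm.sub continuous_const).abs
    · exact continuous_const.max
        (continuous_const.sub ((continuous_apply q.1).sub (continuous_apply q.2)).norm)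
    · exact continuous_const.max
        (((continuous_apply q.1).sub (continuous_apply q.2)).norm.sub continuous_const)
  · intro p α hα h1 h2 h3
    have s1 : ∑ i, |‖p i‖ - 1| ≤ (k : ℝ) * α := by
      calc ∑ i, |‖p i‖ - 1| ≤ ∑ _i : Fin k, α := Finset.sum_le_sum fun i _ => h1 i
        _ = (k : ℝ) * α := by simp
    have s2 : ∑ q ∈ (univ : Finset (Fin k)).offDiag, max 0 (1 - ‖p q.1 - p q.2‖) ≤
        ((k * k : ℕ) : ℝ) * α := by
      calc ∑ q ∈ (univ : Finset (Fin k)).offDiag, max 0 (1 - ‖p q.1 - p q.2‖)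
          ≤ ∑ _q ∈ (univ : Finset (Fin k)).offDiag, α :=
            Finset.sum_le_sum fun q hq => max_le hα (by
              have := h2 q.1 q.2 (mem_offDiag.1 hq).2.2; linarith)
        _ = ((univ : Finset (Fin k)).offDiag.card : ℝ) * α := by simp
        _ ≤ ((k * k : ℕ) : ℝ) * α := by
            gcongr
            have : (univ : Finset (Fin k)).offDiag.card = k * k - k := by
              rw [Finset.offDiag_card, card_univ, Fintype.card_fin]
            rw [this]
            exact_mod_cast Nat.sub_le _ _
    have s3 : ∑ q ∈ E, max 0 (‖p q.1 - p q.2‖ - 1) ≤ (E.card : ℝ) * α := by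
      calc ∑ q ∈ E, max 0 (‖p q.1 - p q.2‖ - 1) ≤ ∑ _q ∈ E, α :=
            Finset.sum_le_sum fun q hq => max_le hα (by have := h3 q hq; linarith)
        _ = (E.card : ℝ) * α := by simp
    have htot : ((k + k * k + E.card : ℕ) : ℝ) * α =
        (k : ℝ) * α + ((k * k : ℕ) : ℝ) * α + (E.card : ℝ) * α := by
      push_cast; ring
    rw [htot]
    linarith
  · intro p hp
    have n1 : 0 ≤ ∑ i, |‖p i‖ - 1| := Finset.sum_nonneg fun i _ => abs_nonneg _
    have n2 : 0 ≤ ∑ q ∈ (univ : Finset (Fin k)).offDiag, max 0 (1 - ‖p q.1 - p q.2‖) :=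
      Finset.sum_nonneg fun q _ => le_max_left _ _
    have n3 : 0 ≤ ∑ q ∈ E, max 0 (‖p q.1 - p q.2‖ - 1) :=
      Finset.sum_nonneg fun q _ => le_max_left _ _
    have e1 : ∑ i, |‖p i‖ - 1| = 0 := by linarith
    have e2 : ∑ q ∈ (univ : Finset (Fin k)).offDiag, max 0 (1 - ‖p q.1 - p q.2‖) = 0 := by
      linarith
    have e3 : ∑ q ∈ E, max 0 (‖p q.1 - p q.2‖ - 1) = 0 := by linarith
    rw [Finset.sum_eq_zero_iff_of_nonneg fun i _ => abs_nonneg _] at e1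
    rw [Finset.sum_eq_zero_iff_of_nonneg fun q _ => le_max_left _ _] at e2 e3
    refine ⟨fun i => ?_, fun i j hij => ?_, fun q hq => ?_⟩
    · have := e1 i (mem_univ i)
      rw [abs_eq_zero] at this
      linarith
    · have hq : (i, j) ∈ (univ : Finset (Fin k)).offDiag :=
        mem_offDiag.2 ⟨mem_univ _, mem_univ _, hij⟩
      have := e2 (i, j) hq
      have h' : 1 - ‖p i - p j‖ ≤ max 0 (1 - ‖p i - p j‖) := le_max_right _ _
      linarith
    · have := e3 q hq
      have h' : ‖p q.1 - p q.2‖ - 1 ≤ max 0 (‖p q.1 - p q.2‖ - 1) := le_max_right _ _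
      linarith

/-- **Compactness, one contact pattern at a time.** For every `k` and every `E`, there is
`a > 0` such that — provided `E` consists of `≥ 49` off-diagonal pairs — for all `α < a` no
`p : Fin k → ℝ³` in the `α`-annulus, pairwise `≥ 1 − α` apart, has all its `E`-pairs at distance
`≤ 1 + α`: the penalty functional attains a positive minimum `m` on the compact box `‖p‖_∞ ≤ 2`
(positive by `contactPattern_false`), and `a = min (m / (k + k² + #E + 1)) 1` works.
[cite: FlatleyTheil2015, Proposition 3.3.1, proof ("Theorem 3.5 and standard compactness
arguments")] -/
private theorem exists_alpha_pattern (h35 : FlatleyEtAl2013_maxContacts) (k : ℕ)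
    (E : Finset (Fin k × Fin k)) :
    ∃ a : ℝ, 0 < a ∧ ((∀ q ∈ E, q.1 ≠ q.2) → 49 ≤ E.card → ∀ α : ℝ, α < a →
      ∀ p : Fin k → EuclideanSpace ℝ (Fin 3), (∀ i, |‖p i‖ - 1| ≤ α) →
      (∀ i j, i ≠ j → 1 - α ≤ ‖p i - p j‖) →
      (∀ q ∈ E, ‖p q.1 - p q.2‖ ≤ 1 + α) → False) := by
  by_cases hyp : (∀ q ∈ E, q.1 ≠ q.2) ∧ 49 ≤ E.card
  swap
  · exact ⟨1, one_pos, fun h h' => absurd ⟨h, h'⟩ hyp⟩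
  obtain ⟨hE, hcard⟩ := hyp
  obtain ⟨Φ, hΦc, hΦle, hΦ0⟩ := exists_contact_functional k E
  have hΦpos : ∀ p, 0 < Φ p := fun p =>
    lt_of_not_ge fun hle =>
      contactPattern_false h35 p (hΦ0 p hle).1 (hΦ0 p hle).2.1 hE (hΦ0 p hle).2.2 hcard
  have hK : IsCompact (Metric.closedBall (0 : Fin k → EuclideanSpace ℝ (Fin 3)) 2) :=
    isCompact_closedBall _ _
  obtain ⟨p₀, -, hmin⟩ :=
    hK.exists_isMinOn ⟨0, Metric.mem_closedBall_self (by norm_num)⟩ hΦc.continuousOn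
  set C : ℝ := ((k + k * k + E.card : ℕ) : ℝ) with hC
  have hC0 : 0 < C + 1 := by positivity
  refine ⟨min (Φ p₀ / (C + 1)) 1, lt_min (div_pos (hΦpos p₀) hC0) one_pos, ?_⟩
  intro _ _ α hα p h1 h2 h3
  have hα1 : α < 1 := hα.trans_le (min_le_right _ _)
  have hαC : α < Φ p₀ / (C + 1) := hα.trans_le (min_le_left _ _)
  -- α ≥ 0: E is non-empty, so k ≥ 1
  obtain ⟨q, hq⟩ : E.Nonempty := by
    rw [← Finset.card_pos]; omega
  have hα0 : 0 ≤ α := (abs_nonneg _).trans (h1 q.1)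
  have hpK : p ∈ Metric.closedBall (0 : Fin k → EuclideanSpace ℝ (Fin 3)) 2 := by
    rw [mem_closedBall_zero_iff, pi_norm_le_iff_of_nonneg (by norm_num : (0 : ℝ) ≤ 2)]
    intro i
    have h := (abs_le.1 (h1 i)).2
    linarith
  have h4 : Φ p₀ ≤ Φ p := (isMinOn_iff.1 hmin) p hpK
  have h5 : Φ p ≤ C * α := hΦle p α hα0 h1 h2 h3
  have h6 : (C + 1) * α < Φ p₀ := by rwa [lt_div_iff₀ hC0, mul_comm] at hαC
  nlinarith

/-- **The perturbed 24-contact bound** (the geometric content of Proposition 3.3.1's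
`½ #𝒜(x) ≤ 24`), modulo Theorem 3.5 (`h35`): there is `α₀ > 0` such that for all `α < α₀`, among
any finite set `T ⊂ ℝ³` of points of the annulus `1 − α ≤ |v| ≤ 1 + α` with pairwise distances
`≥ 1 − α` there are at most `48` ordered pairs `(v, w)`, `v ≠ w`, with `|v − w| ≤ 1 + α` (at most
`24` perturbed contacts). At `α = 0` this is Theorem 3.5. Proof: `#T ≤ 12` by the first clause
(`exists_card_le_twelve_annulus`); index `T` by `Fin #T`; the realised contact pattern has `≥ 49`
pairs if the bound fails; apply `exists_alpha_pattern`, the constant being the minimum over the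
finitely many patterns on `≤ 12` indices.
[cite: FlatleyTheil2015, Proposition 3.3.1 with its proof (Theorems 3.4, 3.5 + compactness)] -/
theorem exists_card_contactPairs_le_annulus (h35 : FlatleyEtAl2013_maxContacts) :
    ∃ α₀ : ℝ, 0 < α₀ ∧ ∀ α : ℝ, α < α₀ → ∀ T : Finset (EuclideanSpace ℝ (Fin 3)),
      (∀ v ∈ T, |‖v‖ - 1| ≤ α) → (∀ v ∈ T, ∀ w ∈ T, v ≠ w → 1 - α ≤ dist v w) →
      ((T ×ˢ T).filter fun q => q.1 ≠ q.2 ∧ dist q.1 q.2 ≤ 1 + α).card ≤ 48 := by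
  classical
  -- uniform α over the finitely many contact patterns on ≤ 12 points
  let I := Σ k : Fin 13, Finset (Fin k × Fin k)
  have hI : ∀ i : I, ∃ a : ℝ, 0 < a ∧ ((∀ q ∈ i.2, q.1 ≠ q.2) → 49 ≤ i.2.card → ∀ α : ℝ, α < a →
      ∀ p : Fin i.1 → EuclideanSpace ℝ (Fin 3), (∀ j, |‖p j‖ - 1| ≤ α) →
      (∀ j j', j ≠ j' → 1 - α ≤ ‖p j - p j'‖) →
      (∀ q ∈ i.2, ‖p q.1 - p q.2‖ ≤ 1 + α) → False) :=
    fun i => exists_alpha_pattern h35 i.1 i.2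
  choose a ha_pos ha using hI
  have hne : (univ : Finset I).Nonempty := ⟨⟨0, ∅⟩, mem_univ _⟩
  set α₁ := univ.inf' hne a with hα₁
  have hα₁pos : 0 < α₁ := by
    rw [hα₁, Finset.lt_inf'_iff]
    exact fun i _ => ha_pos i
  obtain ⟨α₂, hα₂, h12⟩ := exists_card_le_twelve_annulus
  refine ⟨min α₁ α₂, lt_min hα₁pos hα₂, fun α hα T hT1 hT2 => ?_⟩
  have hαa : ∀ i, α < a i := fun i =>
    (hα.trans_le (min_le_left _ _)).trans_le (Finset.inf'_le _ (mem_univ i))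
  have hk : T.card ≤ 12 := h12 α (hα.trans_le (min_le_right _ _)) T hT1 hT2
  by_contra h49
  rw [not_le] at h49
  -- index T
  set k := T.card with hk'
  let e := T.equivFinOfCardEq hk'.symm
  let p : Fin k → EuclideanSpace ℝ (Fin 3) := fun j => (e.symm j : EuclideanSpace ℝ (Fin 3))
  let E : Finset (Fin k × Fin k) :=
    univ.filter fun q => q.1 ≠ q.2 ∧ dist (p q.1) (p q.2) ≤ 1 + α
  have hpinj : Function.Injective p := fun j j' h =>
    e.symm.injective (Subtype.ext h)
  have hEcard : 49 ≤ E.card := by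
    have hsub : ((T ×ˢ T).filter fun q => q.1 ≠ q.2 ∧ dist q.1 q.2 ≤ 1 + α) ⊆
        E.image fun q => (p q.1, p q.2) := by
      intro q hq
      simp only [mem_filter, mem_product] at hq
      obtain ⟨⟨hq1, hq2⟩, hne', hd⟩ := hq
      refine mem_image.2 ⟨(e ⟨q.1, hq1⟩, e ⟨q.2, hq2⟩), ?_, ?_⟩
      · simp only [E, p, mem_filter, mem_univ, true_and, Equiv.symm_apply_apply]
        exact ⟨fun h => hne' (Subtype.ext_iff.1 (e.injective h)), hd⟩
      · simp only [p, Equiv.symm_apply_apply, Prod.mk.eta]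
    calc 49 ≤ _ := h49
      _ ≤ (E.image fun q => (p q.1, p q.2)).card := Finset.card_le_card hsub
      _ ≤ E.card := Finset.card_image_le
  let i : I := ⟨⟨k, by omega⟩, E⟩
  refine ha i (fun q hq => (mem_filter.1 hq).2.1) hEcard α (hαa i) p
    (fun j => hT1 _ (e.symm j).2) (fun j j' hjj' => ?_) (fun q hq => ?_)
  · have hne' : (p j) ≠ (p j') := fun h => hjj' (hpinj h)
    have := hT2 _ (e.symm j).2 _ (e.symm j').2 hne'
    rwa [dist_eq_norm] at this
  · have := (mem_filter.1 hq).2.2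
    rwa [dist_eq_norm] at this

/-- **Proposition 3.3.1, second clause `½ #𝒜(x) ≤ 24`, AS PRINTED** (modulo Theorem 3.5 =
`h35`): there is a constant `α₀ > 0` such that for all `α < α₀` (in particular all
`α ∈ (0, α₀)`), every finite label set `X`, every configuration `y : X → ℝ³` with the minimum
distance bound (eq:mindist) `min_{x ≠ x'} |y(x') − y(x)| > 1 − α`, and every `x ∈ X`:
`#𝒜(x) ≤ 48`, where `𝒜(x) = {q ∈ 𝒩 : q ⊂ N(x)}` is the set of ORDERED pairs
`(x₁, x₂) ∈ N(x) × N(x)` with `||y(x₂) − y(x₁)| − 1| ≤ α` and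
`N(x) = {x' : ||y(x') − y(x)| − 1| ≤ α}` ((2.5), §3.1.2) — i.e. `½ #𝒜(x) ≤ 24`. Proof:
`x' ↦ y(x') − y(x)` maps `N(x)` injectively into the annulus with pairwise distances `≥ 1 − α`
and `𝒜(x)` injectively into the perturbed contact pairs; apply
`exists_card_contactPairs_le_annulus`.
[cite: FlatleyTheil2015, Proposition 3.3.1 (the bound ½ #𝒜(x) ≤ 24)] -/
theorem exists_card_nbhdPairs_le (h35 : FlatleyEtAl2013_maxContacts) :
    ∃ α₀ : ℝ, 0 < α₀ ∧ ∀ α : ℝ, α < α₀ →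
      ∀ {X : Type*} [Fintype X] (y : X → EuclideanSpace ℝ (Fin 3)),
      (∀ x x', x ≠ x' → 1 - α < ‖y x' - y x‖) →
      ∀ x, (((univ.filter fun x' => |‖y x' - y x‖ - 1| ≤ α) ×ˢ
          (univ.filter fun x' => |‖y x' - y x‖ - 1| ≤ α)).filter
          fun q => |‖y q.2 - y q.1‖ - 1| ≤ α).card ≤ 48 := by
  classical
  obtain ⟨α₀, hα₀, h⟩ := exists_card_contactPairs_le_annulus h35
  refine ⟨min α₀ 1, lt_min hα₀ one_pos, ?_⟩
  intro α hα X _ y hsep x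
  have hα₀' : α < α₀ := hα.trans_le (min_le_left _ _)
  have hα1 : α < 1 := hα.trans_le (min_le_right _ _)
  set N := (univ.filter fun x' => |‖y x' - y x‖ - 1| ≤ α : Finset X) with hN
  set T := N.image fun x' => y x' - y x with hT
  have hT1 : ∀ v ∈ T, |‖v‖ - 1| ≤ α := by
    intro v hv
    obtain ⟨a, ha, rfl⟩ := mem_image.1 hv
    exact (mem_filter.1 ha).2
  have hT2 : ∀ v ∈ T, ∀ w ∈ T, v ≠ w → 1 - α ≤ dist v w := by
    intro v hv w hw hvw
    obtain ⟨a, ha, rfl⟩ := mem_image.1 hv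
    obtain ⟨b, hb, rfl⟩ := mem_image.1 hw
    have hab : a ≠ b := fun e => hvw (by rw [e])
    rw [dist_eq_norm, show y a - y x - (y b - y x) = y a - y b by abel]
    exact (hsep b a hab.symm).le
  refine le_trans ?_ (h α hα₀' T hT1 hT2)
  refine Finset.card_le_card_of_injOn (fun q : X × X => (y q.1 - y x, y q.2 - y x)) ?_ ?_
  · intro q hq
    simp only [Finset.mem_coe, Finset.mem_filter, Finset.mem_product] at hq ⊢
    obtain ⟨⟨hq1, hq2⟩, hd⟩ := hq
    refine ⟨⟨mem_image_of_mem _ hq1, mem_image_of_mem _ hq2⟩, ?_, ?_⟩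
    · intro heq
      have : y q.1 = y q.2 := sub_left_injective heq
      rw [this, sub_self, norm_zero] at hd
      have := abs_le.1 hd
      linarith
    · rw [dist_eq_norm, show y q.1 - y x - (y q.2 - y x) = y q.1 - y q.2 by abel, norm_sub_rev]
      have := (abs_le.1 hd).2
      linarith
  · intro q hq q' hq' hqq'
    simp only [Prod.mk.injEq, sub_left_inj] at hqq'
    have hy : Set.InjOn y ↑N := by
      intro a _ b _ hab
      by_contra hne
      have hlt := hsep b a (Ne.symm hne)
      rw [hab, sub_self, norm_zero] at hlt
      linarith
    simp only [Finset.mem_coe, Finset.mem_filter, Finset.mem_product] at hq hq'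
    exact Prod.ext (hy (by simpa using hq.1.1) (by simpa using hq'.1.1) hqq'.1)
      (hy (by simpa using hq.1.2) (by simpa using hq'.1.2) hqq'.2)

end PerturbedContacts

/-! ### Proposition 3.3.2, first assertion: `½ #𝒜(x) = 24` forces `#N(x) = 12` -/

/-- The exact case with FEWER than twelve points: `k ≤ 11` unit vectors pairwise `≥ 1` apart cannot
realise `≥ 48` ordered unit contacts on a prescribed set `E` of index pairs — by Theorem 3.5 an
arrangement with `24` contacts has exactly twelve balls
(`FlatleyEtAl2013_maxContacts.card_eq_twelve`).
[cite: FlatleyTheil2015, Theorem 3.5 and §3.1.1 ("twelve vertices, twenty-four edges")] -/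
theorem contactPattern_false_of_le_eleven (h35 : FlatleyEtAl2013_maxContacts) {k : ℕ} (hk : k ≤ 11)
    (p : Fin k → EuclideanSpace ℝ (Fin 3))
    (h1 : ∀ i, ‖p i‖ = 1) (h2 : ∀ i j, i ≠ j → 1 ≤ ‖p i - p j‖) {E : Finset (Fin k × Fin k)}
    (hE : ∀ q ∈ E, q.1 ≠ q.2) (hE1 : ∀ q ∈ E, ‖p q.1 - p q.2‖ ≤ 1) (hcard : 48 ≤ E.card) :
    False := by
  classical
  have hinj : Function.Injective p := by
    intro i j hij
    by_contra hne
    have h := h2 i j hne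
    rw [hij, sub_self, norm_zero] at h
    linarith
  set Z : Finset (EuclideanSpace ℝ (Fin 3)) := univ.image p with hZ
  have hZcard : Z.card = k := by
    rw [hZ, card_image_of_injective _ hinj, card_univ, Fintype.card_fin]
  have hn : ∀ v ∈ Z, ‖v‖ = 1 := by
    intro v hv
    obtain ⟨i, -, rfl⟩ := mem_image.1 hv
    exact h1 i
  have hsep : ∀ v ∈ Z, ∀ w ∈ Z, v ≠ w → 1 ≤ dist v w := by
    intro v hv w hw hvw
    obtain ⟨i, -, rfl⟩ := mem_image.1 hv
    obtain ⟨j, -, rfl⟩ := mem_image.1 hw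
    rw [dist_eq_norm]
    exact h2 i j fun e => hvw (by rw [e])
  have h48 := (h35 Z hn hsep).1
  have hle : E.card ≤ ((Z ×ˢ Z).filter
      fun q : EuclideanSpace ℝ (Fin 3) × EuclideanSpace ℝ (Fin 3) => dist q.1 q.2 = 1).card := by
    refine Finset.card_le_card_of_injOn (fun q => (p q.1, p q.2)) ?_ ?_
    · intro q hq
      simp only [coe_filter, mem_product, Set.mem_setOf_eq, hZ, mem_image, mem_univ, true_and,
        exists_apply_eq_apply, and_self]
      rw [dist_eq_norm]
      exact le_antisymm (hE1 q hq) (h2 _ _ (hE q hq))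
    · intro q _ q' _ hqq'
      simp only [Prod.mk.injEq] at hqq'
      exact Prod.ext (hinj hqq'.1) (hinj hqq'.2)
  have h48' : ((Z ×ˢ Z).filter
      fun q : EuclideanSpace ℝ (Fin 3) × EuclideanSpace ℝ (Fin 3) => dist q.1 q.2 = 1).card = 48 :=
    by omega
  have h12 := FlatleyEtAl2013_maxContacts.card_eq_twelve h35 Z hn hsep h48'
  omega

/-- Compactness, one contact pattern at a time, for `k ≤ 11` points and `≥ 48` prescribed contacts
(same penalty functional as `exists_alpha_pattern`; exact case =
`contactPattern_false_of_le_eleven`).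
[cite: FlatleyTheil2015, Proposition 3.3, proof ("Theorems 3.4 & 3.5 and standard compactness
arguments")] -/
private theorem exists_alpha_pattern_le (h35 : FlatleyEtAl2013_maxContacts) (k : ℕ)
    (E : Finset (Fin k × Fin k)) :
    ∃ a : ℝ, 0 < a ∧ (k ≤ 11 → (∀ q ∈ E, q.1 ≠ q.2) → 48 ≤ E.card → ∀ α : ℝ, α < a →
      ∀ p : Fin k → EuclideanSpace ℝ (Fin 3), (∀ i, |‖p i‖ - 1| ≤ α) →
      (∀ i j, i ≠ j → 1 - α ≤ ‖p i - p j‖) →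
      (∀ q ∈ E, ‖p q.1 - p q.2‖ ≤ 1 + α) → False) := by
  by_cases hyp : k ≤ 11 ∧ (∀ q ∈ E, q.1 ≠ q.2) ∧ 48 ≤ E.card
  swap
  · exact ⟨1, one_pos, fun h h' h'' => absurd ⟨h, h', h''⟩ hyp⟩
  obtain ⟨hk, hE, hcard⟩ := hyp
  obtain ⟨Φ, hΦc, hΦle, hΦ0⟩ := exists_contact_functional k E
  have hΦpos : ∀ p, 0 < Φ p := fun p =>
    lt_of_not_ge fun hle =>
      contactPattern_false_of_le_eleven h35 hk p (hΦ0 p hle).1 (hΦ0 p hle).2.1 hE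
        (hΦ0 p hle).2.2 hcard
  have hK : IsCompact (Metric.closedBall (0 : Fin k → EuclideanSpace ℝ (Fin 3)) 2) :=
    isCompact_closedBall _ _
  obtain ⟨p₀, -, hmin⟩ :=
    hK.exists_isMinOn ⟨0, Metric.mem_closedBall_self (by norm_num)⟩ hΦc.continuousOn
  set C : ℝ := ((k + k * k + E.card : ℕ) : ℝ) with hC
  have hC0 : 0 < C + 1 := by positivity
  refine ⟨min (Φ p₀ / (C + 1)) 1, lt_min (div_pos (hΦpos p₀) hC0) one_pos, ?_⟩
  intro _ _ _ α hα p h1 h2 h3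
  have hα1 : α < 1 := hα.trans_le (min_le_right _ _)
  have hαC : α < Φ p₀ / (C + 1) := hα.trans_le (min_le_left _ _)
  obtain ⟨q, hq⟩ : E.Nonempty := by
    rw [← Finset.card_pos]; omega
  have hα0 : 0 ≤ α := (abs_nonneg _).trans (h1 q.1)
  have hpK : p ∈ Metric.closedBall (0 : Fin k → EuclideanSpace ℝ (Fin 3)) 2 := by
    rw [mem_closedBall_zero_iff, pi_norm_le_iff_of_nonneg (by norm_num : (0 : ℝ) ≤ 2)]
    intro i
    have h := (abs_le.1 (h1 i)).2
    linarith
  have h4 : Φ p₀ ≤ Φ p := (isMinOn_iff.1 hmin) p hpK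
  have h5 : Φ p ≤ C * α := hΦle p α hα0 h1 h2 h3
  have h6 : (C + 1) * α < Φ p₀ := by rwa [lt_div_iff₀ hC0, mul_comm] at hαC
  nlinarith

/-- **Proposition 3.3.2, first assertion, geometric form (modulo Theorem 3.5 = `h35`):** there is
`α₀ > 0` such that for all `α < α₀`, a finite set `T` of points of the annulus
`1 − α ≤ |v| ≤ 1 + α` with pairwise distances `≥ 1 − α` and at least `48` ordered pairs `(v, w)`,
`v ≠ w`, with `|v − w| ≤ 1 + α` has EXACTLY twelve points ("If `½ #𝒜(x) = 24`, then
`#N(x) = 12`"). [cite: FlatleyTheil2015, Proposition 3.3.2 (first assertion) with its proof] -/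
theorem exists_card_eq_twelve_of_contactPairs_annulus (h35 : FlatleyEtAl2013_maxContacts) :
    ∃ α₀ : ℝ, 0 < α₀ ∧ ∀ α : ℝ, α < α₀ → ∀ T : Finset (EuclideanSpace ℝ (Fin 3)),
      (∀ v ∈ T, |‖v‖ - 1| ≤ α) → (∀ v ∈ T, ∀ w ∈ T, v ≠ w → 1 - α ≤ dist v w) →
      48 ≤ ((T ×ˢ T).filter fun q => q.1 ≠ q.2 ∧ dist q.1 q.2 ≤ 1 + α).card → T.card = 12 := by
  classical
  let I := Σ k : Fin 13, Finset (Fin k × Fin k)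
  have hI : ∀ i : I, ∃ a : ℝ, 0 < a ∧ ((i.1 : ℕ) ≤ 11 → (∀ q ∈ i.2, q.1 ≠ q.2) → 48 ≤ i.2.card →
      ∀ α : ℝ, α < a →
      ∀ p : Fin i.1 → EuclideanSpace ℝ (Fin 3), (∀ j, |‖p j‖ - 1| ≤ α) →
      (∀ j j', j ≠ j' → 1 - α ≤ ‖p j - p j'‖) →
      (∀ q ∈ i.2, ‖p q.1 - p q.2‖ ≤ 1 + α) → False) :=
    fun i => exists_alpha_pattern_le h35 i.1 i.2
  choose a ha_pos ha using hI
  have hne : (univ : Finset I).Nonempty := ⟨⟨0, ∅⟩, mem_univ _⟩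
  set α₁ := univ.inf' hne a with hα₁
  have hα₁pos : 0 < α₁ := by
    rw [hα₁, Finset.lt_inf'_iff]
    exact fun i _ => ha_pos i
  obtain ⟨α₂, hα₂, h12⟩ := exists_card_le_twelve_annulus
  refine ⟨min α₁ α₂, lt_min hα₁pos hα₂, fun α hα T hT1 hT2 h48 => ?_⟩
  have hαa : ∀ i, α < a i := fun i =>
    (hα.trans_le (min_le_left _ _)).trans_le (Finset.inf'_le _ (mem_univ i))
  have hk : T.card ≤ 12 := h12 α (hα.trans_le (min_le_right _ _)) T hT1 hT2
  by_contra hne12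
  have hk11 : T.card ≤ 11 := by omega
  set k := T.card with hk'
  let e := T.equivFinOfCardEq hk'.symm
  let p : Fin k → EuclideanSpace ℝ (Fin 3) := fun j => (e.symm j : EuclideanSpace ℝ (Fin 3))
  let E : Finset (Fin k × Fin k) :=
    univ.filter fun q => q.1 ≠ q.2 ∧ dist (p q.1) (p q.2) ≤ 1 + α
  have hpinj : Function.Injective p := fun j j' h =>
    e.symm.injective (Subtype.ext h)
  have hEcard : 48 ≤ E.card := by
    have hsub : ((T ×ˢ T).filter fun q => q.1 ≠ q.2 ∧ dist q.1 q.2 ≤ 1 + α) ⊆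
        E.image fun q => (p q.1, p q.2) := by
      intro q hq
      simp only [mem_filter, mem_product] at hq
      obtain ⟨⟨hq1, hq2⟩, hne', hd⟩ := hq
      refine mem_image.2 ⟨(e ⟨q.1, hq1⟩, e ⟨q.2, hq2⟩), ?_, ?_⟩
      · simp only [E, p, mem_filter, mem_univ, true_and, Equiv.symm_apply_apply]
        exact ⟨fun h => hne' (Subtype.ext_iff.1 (e.injective h)), hd⟩
      · simp only [p, Equiv.symm_apply_apply, Prod.mk.eta]
    calc 48 ≤ _ := h48
      _ ≤ (E.image fun q => (p q.1, p q.2)).card := Finset.card_le_card hsub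
      _ ≤ E.card := Finset.card_image_le
  let i : I := ⟨⟨k, by omega⟩, E⟩
  refine ha i hk11 (fun q hq => (mem_filter.1 hq).2.1) hEcard α (hαa i) p
    (fun j => hT1 _ (e.symm j).2) (fun j j' hjj' => ?_) (fun q hq => ?_)
  · have hne' : (p j) ≠ (p j') := fun h => hjj' (hpinj h)
    have := hT2 _ (e.symm j).2 _ (e.symm j').2 hne'
    rwa [dist_eq_norm] at this
  · have := (mem_filter.1 hq).2.2
    rwa [dist_eq_norm] at this

/-- **Proposition 3.3.2, first assertion, AS PRINTED (modulo Theorem 3.5 = `h35`)**: there is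
`α₀ > 0` such that for all `α < α₀`, every finite label set `X`, every `y : X → ℝ³` with
(eq:mindist) and every `x ∈ X`: if `#𝒜(x) ≥ 48` (in particular if `½ #𝒜(x) = 24`) then
`#N(x) = 12`. [cite: FlatleyTheil2015, Proposition 3.3.2 ("If ½ #𝒜(x) = 24, then #N(x) = 12")] -/
theorem exists_card_nbhd_eq_twelve_of_pairs (h35 : FlatleyEtAl2013_maxContacts) :
    ∃ α₀ : ℝ, 0 < α₀ ∧ ∀ α : ℝ, α < α₀ →
      ∀ {X : Type*} [Fintype X] (y : X → EuclideanSpace ℝ (Fin 3)),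
      (∀ x x', x ≠ x' → 1 - α < ‖y x' - y x‖) →
      ∀ x, 48 ≤ (((univ.filter fun x' => |‖y x' - y x‖ - 1| ≤ α) ×ˢ
          (univ.filter fun x' => |‖y x' - y x‖ - 1| ≤ α)).filter
          fun q => |‖y q.2 - y q.1‖ - 1| ≤ α).card →
        (univ.filter fun x' => |‖y x' - y x‖ - 1| ≤ α).card = 12 := by
  classical
  obtain ⟨α₀, hα₀, h⟩ := exists_card_eq_twelve_of_contactPairs_annulus h35
  refine ⟨min α₀ 1, lt_min hα₀ one_pos, ?_⟩
  intro α hα X _ y hsep x h48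
  have hα₀' : α < α₀ := hα.trans_le (min_le_left _ _)
  have hα1 : α < 1 := hα.trans_le (min_le_right _ _)
  set N := (univ.filter fun x' => |‖y x' - y x‖ - 1| ≤ α : Finset X) with hN
  have hy : Set.InjOn (fun x' => y x' - y x) ↑N := by
    intro a _ b _ hab
    by_contra hne
    have hlt := hsep b a (Ne.symm hne)
    have : y a = y b := sub_left_injective hab
    rw [this, sub_self, norm_zero] at hlt
    linarith
  set T := N.image fun x' => y x' - y x with hT
  have hT1 : ∀ v ∈ T, |‖v‖ - 1| ≤ α := by
    intro v hv
    obtain ⟨a, ha, rfl⟩ := mem_image.1 hv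
    exact (mem_filter.1 ha).2
  have hT2 : ∀ v ∈ T, ∀ w ∈ T, v ≠ w → 1 - α ≤ dist v w := by
    intro v hv w hw hvw
    obtain ⟨a, ha, rfl⟩ := mem_image.1 hv
    obtain ⟨b, hb, rfl⟩ := mem_image.1 hw
    have hab : a ≠ b := fun e => hvw (by rw [e])
    rw [dist_eq_norm, show y a - y x - (y b - y x) = y a - y b by abel]
    exact (hsep b a hab.symm).le
  have hTcard : T.card = N.card := card_image_of_injOn hy
  rw [← hTcard]
  refine h α hα₀' T hT1 hT2 (le_trans h48 ?_)
  refine Finset.card_le_card_of_injOn (fun q : X × X => (y q.1 - y x, y q.2 - y x)) ?_ ?_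
  · intro q hq
    simp only [Finset.mem_coe, Finset.mem_filter, Finset.mem_product] at hq ⊢
    obtain ⟨⟨hq1, hq2⟩, hd⟩ := hq
    refine ⟨⟨mem_image_of_mem _ hq1, mem_image_of_mem _ hq2⟩, ?_, ?_⟩
    · intro heq
      have : y q.1 = y q.2 := sub_left_injective heq
      rw [this, sub_self, norm_zero] at hd
      have := abs_le.1 hd
      linarith
    · rw [dist_eq_norm, show y q.1 - y x - (y q.2 - y x) = y q.1 - y q.2 by abel, norm_sub_rev]
      have := (abs_le.1 hd).2
      linarith
  · intro q hq q' hq' hqq'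
    simp only [Prod.mk.injEq, sub_left_inj] at hqq'
    simp only [Finset.mem_coe, Finset.mem_filter, Finset.mem_product] at hq hq'
    have hy' : Set.InjOn y ↑N := by
      intro a _ b _ hab
      by_contra hne
      have hlt := hsep b a (Ne.symm hne)
      rw [hab, sub_self, norm_zero] at hlt
      linarith
    exact Prod.ext (hy' (by simpa using hq.1.1) (by simpa using hq'.1.1) hqq'.1)
      (hy' (by simpa using hq.1.2) (by simpa using hq'.1.2) hqq'.2)

/-! ### The three-body local bound (tbound): `e₃(x) ≥ 48 Ψ(1,1,1)`, and `≥ 46 Ψ(1,1,1)` off `X_reg`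
-/

/-- `#𝒜(x)` is even: `𝒜(x)` consists of off-diagonal ordered pairs and is invariant under swapping
(`α < 1`). [folklore] -/
private theorem even_card_nbhdPairs {X : Type*} [Fintype X] (y : X → EuclideanSpace ℝ (Fin 3))
    {α : ℝ} (hα1 : α < 1) (x : X) :
    Even (((univ.filter fun x' => |‖y x' - y x‖ - 1| ≤ α) ×ˢ
          (univ.filter fun x' => |‖y x' - y x‖ - 1| ≤ α)).filter
          fun q => |‖y q.2 - y q.1‖ - 1| ≤ α).card := by
  classical
  set A := (((univ.filter fun x' => |‖y x' - y x‖ - 1| ≤ α) ×ˢ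
          (univ.filter fun x' => |‖y x' - y x‖ - 1| ≤ α)).filter
          fun q => |‖y q.2 - y q.1‖ - 1| ≤ α) with hA
  have hsum : ∑ q ∈ A, (1 : ZMod 2) = 0 := by
    refine Finset.sum_involution (fun q _ => q.swap) (fun q _ => by decide) (fun q hq _ => ?_)
      (fun q hq => ?_) (fun q _ => Prod.swap_swap q)
    · intro h
      have hq' := (mem_filter.1 hq).2
      have h1 : q.1 = q.2 := by
        have := congrArg Prod.fst h
        simpa using this.symm
      rw [h1, sub_self, norm_zero] at hq'
      have := abs_le.1 hq'
      linarith
    · simp only [hA, mem_filter, mem_product, Prod.fst_swap, Prod.snd_swap] at hq ⊢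
      refine ⟨⟨hq.1.2, hq.1.1⟩, ?_⟩
      rw [norm_sub_rev]
      exact hq.2
  rw [Finset.sum_const, nsmul_eq_mul, mul_one] at hsum
  exact (ZMod.natCast_eq_zero_iff_even).1 hsum

/-- **The three-body local bound (tbound), AS PRINTED (modulo Theorem 3.5 = `h35`):** "Proposition
3.3.1 implies that `e₃(x) ≥ 48 Ψ(1,1,1)` if `x ∈ X_reg`, `46 Ψ(1,1,1)` else", where
`e₃(x) := 2 Σ_{{x₁,x₂} ⊂ X∖{x}} V₃(y(x), y(x₁), y(x₂))` (§6 p. 17), `V₃(y₁,y₂,y₃) =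
Ψ(|y₂−y₁|, |y₃−y₂|, |y₁−y₃|)` (2.1), `Ψ(1,1,1) = −1 = min Ψ` and `Ψ ≥ 0` as soon as one side is
`α`-far from `1` (Definition 2.1 item 2, the tree's `IsLocalizedTriple`), and `x ∈ X_reg` iff
`½ #𝒜(x) = 24` (Definition 3.6). Rendered: there is `α₀ > 0` such that for all `α < α₀`, every
`Ψ` with `IsLocalizedTriple α Ψ`, every finite `X`, every `y : X → ℝ³` with (eq:mindist) and every
`x`: `48 · Ψ(1,1,1) ≤ e₃(x)` (always, since `#𝒜(x) ≤ 48` and every other ordered triple contributes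
`≥ 0`), and `46 · Ψ(1,1,1) ≤ e₃(x)` whenever `#𝒜(x) ≠ 48` (then `#𝒜(x) ≤ 46`, being even); here
`e₃(x) = Σ_{x₁ ≠ x} Σ_{x₂ ≠ x, x₁} Ψ(sideLengths (y x) (y x₁) (y x₂))` is the ordered double sum
(each unordered pair twice, as printed). [cite: FlatleyTheil2015, §6 (tbound) (arXiv p. 17) with
Proposition 3.3.1 and Definition 2.1 item 2] -/
theorem exists_threeBody_lowerBound (h35 : FlatleyEtAl2013_maxContacts) :
    ∃ α₀ : ℝ, 0 < α₀ ∧ ∀ α : ℝ, α < α₀ → ∀ (Ψ : (Fin 3 → ℝ) → ℝ),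
      Literature.Barriers.AtomisticToContinuum.FlatleyTheil2015.IsLocalizedTriple α Ψ →
      ∀ {X : Type*} [Fintype X] [DecidableEq X] (y : X → EuclideanSpace ℝ (Fin 3)),
      (∀ x x', x ≠ x' → 1 - α < ‖y x' - y x‖) → ∀ x,
      48 * Ψ (fun _ => 1) ≤ ∑ x₁ ∈ univ.erase x, ∑ x₂ ∈ (univ.erase x).erase x₁,
          Ψ (sideLengths (y x) (y x₁) (y x₂)) ∧
      ((((univ.filter fun x' => |‖y x' - y x‖ - 1| ≤ α) ×ˢ
          (univ.filter fun x' => |‖y x' - y x‖ - 1| ≤ α)).filter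
          fun q => |‖y q.2 - y q.1‖ - 1| ≤ α).card ≠ 48 →
        46 * Ψ (fun _ => 1) ≤ ∑ x₁ ∈ univ.erase x, ∑ x₂ ∈ (univ.erase x).erase x₁,
          Ψ (sideLengths (y x) (y x₁) (y x₂))) := by
  classical
  obtain ⟨α₀, hα₀, h⟩ := exists_card_nbhdPairs_le h35
  refine ⟨min α₀ 1, lt_min hα₀ one_pos, ?_⟩
  intro α hα Ψ hΨ X _ _ y hsep x
  have hα₀' : α < α₀ := hα.trans_le (min_le_left _ _)
  have hα1 : α < 1 := hα.trans_le (min_le_right _ _)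
  set A := (((univ.filter fun x' => |‖y x' - y x‖ - 1| ≤ α) ×ˢ
          (univ.filter fun x' => |‖y x' - y x‖ - 1| ≤ α)).filter
          fun q => |‖y q.2 - y q.1‖ - 1| ≤ α) with hA
  have hA48 : A.card ≤ 48 := h α hα₀' y hsep x
  -- the ordered double sum as a sum over off-diagonal pairs avoiding `x`
  set P := ((univ.erase x) ×ˢ (univ.erase x)).filter (fun q : X × X => q.1 ≠ q.2) with hP
  have hsumP : ∑ x₁ ∈ univ.erase x, ∑ x₂ ∈ (univ.erase x).erase x₁,
      Ψ (sideLengths (y x) (y x₁) (y x₂)) = ∑ q ∈ P, Ψ (sideLengths (y x) (y q.1) (y q.2)) := by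
    rw [hP, Finset.sum_filter, Finset.sum_product]
    refine Finset.sum_congr rfl fun x₁ _ => ?_
    rw [Finset.sum_ite, Finset.sum_const_zero, add_zero]
    refine Finset.sum_congr ?_ fun _ _ => rfl
    ext x₂
    simp only [mem_erase, mem_filter, mem_univ, and_true, ne_eq]
    tauto
  have hAP : A ⊆ P := by
    intro q hq
    simp only [hA, mem_filter, mem_product, mem_univ, true_and] at hq
    simp only [hP, mem_filter, mem_product, mem_erase, mem_univ, and_true, ne_eq]
    obtain ⟨⟨hq1, hq2⟩, hd⟩ := hq
    refine ⟨⟨fun h1 => ?_, fun h2 => ?_⟩, fun h12 => ?_⟩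
    · rw [h1, sub_self, norm_zero] at hq1; have := abs_le.1 hq1; linarith
    · rw [h2, sub_self, norm_zero] at hq2; have := abs_le.1 hq2; linarith
    · rw [h12, sub_self, norm_zero] at hd; have := abs_le.1 hd; linarith
  have hside_nonneg : ∀ q : X × X, ∀ i, 0 ≤ sideLengths (y x) (y q.1) (y q.2) i := by
    intro q i
    fin_cases i <;> simp [sideLengths]
  -- every term is ≥ -1, and ≥ 0 off A
  have hterm : ∀ q ∈ P,
      (if q ∈ A then (-1 : ℝ) else 0) ≤ Ψ (sideLengths (y x) (y q.1) (y q.2)) := by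
    intro q _
    split_ifs with hq
    · exact hΨ.min _ (hside_nonneg q)
    · refine hΨ.nonneg _ (hside_nonneg q) ?_
      simp only [hA, mem_filter, mem_product, mem_univ, true_and, not_and_or, not_le] at hq
      rcases hq with (h1 | h2) | h3
      · exact ⟨0, by simpa [sideLengths] using h1.le⟩
      · refine ⟨2, ?_⟩
        simpa [sideLengths, norm_sub_rev] using h2.le
      · refine ⟨1, ?_⟩
        simpa [sideLengths] using h3.le
  have hlow : -(A.card : ℝ) ≤ ∑ q ∈ P, Ψ (sideLengths (y x) (y q.1) (y q.2)) := by
    calc -(A.card : ℝ) = ∑ q ∈ P, (if q ∈ A then (-1 : ℝ) else 0) := by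
          rw [Finset.sum_ite_mem, (Finset.inter_eq_right.2 hAP), Finset.sum_const, nsmul_eq_mul,
            mul_neg, mul_one]
      _ ≤ _ := Finset.sum_le_sum hterm
  rw [hsumP, hΨ.apply_one]
  refine ⟨?_, fun hne => ?_⟩
  · have h48r : (A.card : ℝ) ≤ 48 := by exact_mod_cast hA48
    linarith
  · have heven : Even A.card := even_card_nbhdPairs y hα1 x
    have h46 : A.card ≤ 46 := by
      obtain ⟨m, hm⟩ := heven
      omega
    have : (A.card : ℝ) ≤ 46 := by exact_mod_cast h46
    linarith

/-! ### Proposition 3.3.2: the local chart (modulo Theorem 3.5), in `δ`-form -/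

/-- **Compactness with closeness, one contact pattern at a time** (`k = 12`). For a pattern `E` of
`≥ 48` off-diagonal pairs and every `δ > 0` there is `a > 0` such that for all `α < a`, every
`p : Fin 12 → ℝ³` in the `α`-annulus, pairwise `≥ 1 − α` apart, with its `E`-pairs at distance
`≤ 1 + α`, is `δ`-close (index by index) to an EXACT configuration `q` (unit vectors, pairwise
`≥ 1`, `E`-pairs at distance `≤ 1`). Proof: the exact configurations form the compact zero set
`G` of the penalty functional inside the box `‖p‖_∞ ≤ 2`; on the compact set of box points at
`infDist ≥ δ` from `G` the functional has a positive minimum `m`, while it is `≤ (156 + #E) α` at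
`p`. [cite: FlatleyTheil2015, Proposition 3.3.2, proof ("standard compactness arguments")] -/
private theorem exists_alpha_close (E : Finset (Fin 12 × Fin 12)) {δ : ℝ} (hδ : 0 < δ) :
    ∃ a : ℝ, 0 < a ∧ ((∀ e ∈ E, e.1 ≠ e.2) → 48 ≤ E.card → ∀ α : ℝ, α < a →
      ∀ p : Fin 12 → EuclideanSpace ℝ (Fin 3), (∀ i, |‖p i‖ - 1| ≤ α) →
      (∀ i j, i ≠ j → 1 - α ≤ ‖p i - p j‖) → (∀ e ∈ E, ‖p e.1 - p e.2‖ ≤ 1 + α) →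
      ∃ q : Fin 12 → EuclideanSpace ℝ (Fin 3), (∀ i, ‖q i‖ = 1) ∧
        (∀ i j, i ≠ j → 1 ≤ ‖q i - q j‖) ∧ (∀ e ∈ E, ‖q e.1 - q e.2‖ ≤ 1) ∧
        ∀ i, ‖p i - q i‖ < δ) := by
  by_cases hyp : (∀ e ∈ E, e.1 ≠ e.2) ∧ 48 ≤ E.card
  swap
  · exact ⟨1, one_pos, fun h h' => absurd ⟨h, h'⟩ hyp⟩
  obtain ⟨hE, hcard⟩ := hyp
  obtain ⟨Φ, hΦc, hΦle, hΦ0⟩ := exists_contact_functional 12 E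
  set K : Set (Fin 12 → EuclideanSpace ℝ (Fin 3)) := Metric.closedBall 0 2 with hK
  have hKc : IsCompact K := isCompact_closedBall _ _
  set G : Set (Fin 12 → EuclideanSpace ℝ (Fin 3)) := K ∩ {q | Φ q ≤ 0} with hG
  have hGc : IsCompact G := hKc.inter_right (isClosed_le hΦc continuous_const)
  set C : ℝ := ((12 + 12 * 12 + E.card : ℕ) : ℝ) with hC
  have hC0 : 0 < C + 1 := by positivity
  obtain ⟨e₀, he₀⟩ : E.Nonempty := by rw [← Finset.card_pos]; omega
  -- membership in the box and the bound `Φ p ≤ C α` for an `α`-configuration, `α < 1`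
  have hbox : ∀ (α : ℝ) (p : Fin 12 → EuclideanSpace ℝ (Fin 3)), α < 1 →
      (∀ i, |‖p i‖ - 1| ≤ α) → p ∈ K := by
    intro α p hα1 h1
    rw [hK, mem_closedBall_zero_iff, pi_norm_le_iff_of_nonneg (by norm_num : (0 : ℝ) ≤ 2)]
    intro i
    have h := (abs_le.1 (h1 i)).2
    linarith
  have hexact : ∀ q ∈ G, (∀ i, ‖q i‖ = 1) ∧ (∀ i j, i ≠ j → 1 ≤ ‖q i - q j‖) ∧
      ∀ e ∈ E, ‖q e.1 - q e.2‖ ≤ 1 := fun q hq => hΦ0 q hq.2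
  by_cases hGne : G.Nonempty
  · -- the compact set of box points `δ`-far from `G`
    set B : Set (Fin 12 → EuclideanSpace ℝ (Fin 3)) := K ∩ {p | δ ≤ Metric.infDist p G} with hB
    have hBc : IsCompact B :=
      hKc.inter_right (isClosed_le continuous_const (Metric.continuous_infDist_pt G))
    -- a positive lower bound of `Φ` on `B` (or `B = ∅`)
    obtain ⟨m, hm, hmB⟩ : ∃ m : ℝ, 0 < m ∧ ∀ p ∈ B, m ≤ Φ p := by
      by_cases hBne : B.Nonempty
      · obtain ⟨p₀, hp₀, hmin⟩ := hBc.exists_isMinOn hBne hΦc.continuousOn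
        refine ⟨Φ p₀, lt_of_not_ge fun hle => ?_, fun p hp => (isMinOn_iff.1 hmin) p hp⟩
        have hp₀G : p₀ ∈ G := ⟨hp₀.1, hle⟩
        have h0 : Metric.infDist p₀ G = 0 := Metric.infDist_zero_of_mem hp₀G
        have := hp₀.2
        simp only [Set.mem_setOf_eq, h0] at this
        linarith
      · exact ⟨1, one_pos, fun p hp => absurd ⟨p, hp⟩ hBne⟩
    refine ⟨min (m / (C + 1)) 1, lt_min (div_pos hm hC0) one_pos, ?_⟩
    intro _ _ α hα p h1 h2 h3
    have hα1 : α < 1 := hα.trans_le (min_le_right _ _)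
    have hαC : α < m / (C + 1) := hα.trans_le (min_le_left _ _)
    have hα0 : 0 ≤ α := (abs_nonneg _).trans (h1 e₀.1)
    have hpK : p ∈ K := hbox α p hα1 h1
    have h5 : Φ p ≤ C * α := hΦle p α hα0 h1 h2 h3
    have h6 : (C + 1) * α < m := by rwa [lt_div_iff₀ hC0, mul_comm] at hαC
    have hpB : p ∉ B := by
      intro hpB
      have := hmB p hpB
      nlinarith
    have hdist : Metric.infDist p G < δ := by
      by_contra hge
      exact hpB ⟨hpK, not_lt.1 hge⟩
    obtain ⟨q, hqG, hpq⟩ := (Metric.infDist_lt_iff hGne).1 hdist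
    refine ⟨q, (hexact q hqG).1, (hexact q hqG).2.1, (hexact q hqG).2.2, fun i => ?_⟩
    calc ‖p i - q i‖ = dist (p i) (q i) := (dist_eq_norm _ _).symm
      _ ≤ dist p q := dist_le_pi_dist p q i
      _ < δ := hpq
  · -- no exact configuration with this pattern: `Φ > 0` on the box, and `α`-configurations
    -- with small `α` do not exist at all
    have hΦpos : ∀ p ∈ K, 0 < Φ p := fun p hp =>
      lt_of_not_ge fun hle => hGne ⟨p, hp, hle⟩
    obtain ⟨p₀, hp₀, hmin⟩ :=
      hKc.exists_isMinOn ⟨0, Metric.mem_closedBall_self (by norm_num)⟩ hΦc.continuousOn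
    refine ⟨min (Φ p₀ / (C + 1)) 1, lt_min (div_pos (hΦpos p₀ hp₀) hC0) one_pos, ?_⟩
    intro _ _ α hα p h1 h2 h3
    exfalso
    have hα1 : α < 1 := hα.trans_le (min_le_right _ _)
    have hαC : α < Φ p₀ / (C + 1) := hα.trans_le (min_le_left _ _)
    have hα0 : 0 ≤ α := (abs_nonneg _).trans (h1 e₀.1)
    have hpK : p ∈ K := hbox α p hα1 h1
    have h4 : Φ p₀ ≤ Φ p := (isMinOn_iff.1 hmin) p hpK
    have h5 : Φ p ≤ C * α := hΦle p α hα0 h1 h2 h3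
    have h6 : (C + 1) * α < Φ p₀ := by rwa [lt_div_iff₀ hC0, mul_comm] at hαC
    nlinarith

/-- **The compactness core of Proposition 3.3.2, geometric form** (modulo Theorem 3.5 = `h35`):
for every `δ > 0` there is `α₀ > 0` such that for all `α < α₀`, twelve points `p₀, …, p₁₁` of the
`α`-annulus, pairwise `≥ 1 − α` apart, with at least `48` ordered pairs `(i, j)`, `i ≠ j`, at
distance `≤ 1 + α`, are `δ`-close index by index to `A η₀, …, A η₁₁` for a linear isometry `A`
and an enumeration `η` of the cuboctahedron `Cub` or of the twisted cuboctahedron `TCub` whose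
unit-distance pairs are EXACTLY the `(1 + α)`-contact pairs of `p`.
[cite: FlatleyTheil2015, Proposition 3.3.2 with its proof (Theorem 3.5 + compactness)] -/
theorem exists_close_pattern_of_contactPairs (h35 : FlatleyEtAl2013_maxContacts) {δ : ℝ}
    (hδ : 0 < δ) :
    ∃ α₀ : ℝ, 0 < α₀ ∧ ∀ α : ℝ, α < α₀ → ∀ p : Fin 12 → EuclideanSpace ℝ (Fin 3),
      (∀ i, |‖p i‖ - 1| ≤ α) → (∀ i j, i ≠ j → 1 - α ≤ ‖p i - p j‖) →
      48 ≤ (univ.filter fun e : Fin 12 × Fin 12 => e.1 ≠ e.2 ∧ ‖p e.1 - p e.2‖ ≤ 1 + α).card →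
      ∃ (P : Finset (EuclideanSpace ℝ (Fin 3)))
        (A : EuclideanSpace ℝ (Fin 3) →ₗᵢ[ℝ] EuclideanSpace ℝ (Fin 3))
        (η : Fin 12 → EuclideanSpace ℝ (Fin 3)),
        (P = Literature.Geometry.DiscreteGeometry.fccKissingPattern ∨
          P = Literature.Geometry.DiscreteGeometry.hcpKissingPattern) ∧
        univ.image η = P ∧ Function.Injective η ∧ (∀ i, ‖p i - A (η i)‖ < δ) ∧
        ∀ i j, i ≠ j → (‖p i - p j‖ ≤ 1 + α ↔ dist (η i) (η j) = 1) := by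
  classical
  -- uniform `α` over the finitely many patterns on twelve indices
  have hI : ∀ E : Finset (Fin 12 × Fin 12), ∃ a : ℝ, 0 < a ∧ ((∀ e ∈ E, e.1 ≠ e.2) →
      48 ≤ E.card → ∀ α : ℝ, α < a →
      ∀ p : Fin 12 → EuclideanSpace ℝ (Fin 3), (∀ i, |‖p i‖ - 1| ≤ α) →
      (∀ i j, i ≠ j → 1 - α ≤ ‖p i - p j‖) → (∀ e ∈ E, ‖p e.1 - p e.2‖ ≤ 1 + α) →
      ∃ q : Fin 12 → EuclideanSpace ℝ (Fin 3), (∀ i, ‖q i‖ = 1) ∧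
        (∀ i j, i ≠ j → 1 ≤ ‖q i - q j‖) ∧ (∀ e ∈ E, ‖q e.1 - q e.2‖ ≤ 1) ∧
        ∀ i, ‖p i - q i‖ < δ) := fun E => exists_alpha_close E hδ
  choose a ha_pos ha using hI
  have hne : (univ : Finset (Finset (Fin 12 × Fin 12))).Nonempty := ⟨∅, mem_univ _⟩
  set α₁ := univ.inf' hne a with hα₁
  have hα₁pos : 0 < α₁ := by
    rw [hα₁, Finset.lt_inf'_iff]
    exact fun E _ => ha_pos E
  refine ⟨α₁, hα₁pos, fun α hα p h1 h2 h48 => ?_⟩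
  set E := (univ.filter fun e : Fin 12 × Fin 12 => e.1 ≠ e.2 ∧ ‖p e.1 - p e.2‖ ≤ 1 + α) with hEdef
  have hαa : α < a E := hα.trans_le (Finset.inf'_le _ (mem_univ E))
  obtain ⟨q, hq1, hq2, hq3, hq4⟩ := ha E (fun e he => (mem_filter.1 he).2.1) h48 α hαa p h1 h2
    (fun e he => (mem_filter.1 he).2.2)
  -- the exact configuration `q` is a (twisted) cuboctahedron with contact set exactly `E`
  have hinj : Function.Injective q := by
    intro i j hij
    by_contra hne'
    have h := hq2 i j hne'
    rw [hij, sub_self, norm_zero] at h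
    linarith
  set Z : Finset (EuclideanSpace ℝ (Fin 3)) := univ.image q with hZ
  have hn : ∀ v ∈ Z, ‖v‖ = 1 := by
    intro v hv
    obtain ⟨i, -, rfl⟩ := mem_image.1 hv
    exact hq1 i
  have hsep : ∀ v ∈ Z, ∀ w ∈ Z, v ≠ w → 1 ≤ dist v w := by
    intro v hv w hw hvw
    obtain ⟨i, -, rfl⟩ := mem_image.1 hv
    obtain ⟨j, -, rfl⟩ := mem_image.1 hw
    rw [dist_eq_norm]
    exact hq2 i j fun e => hvw (by rw [e])
  obtain ⟨h48Z, hcase⟩ := h35 Z hn hsep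
  -- any set `F ⊇`-like of index pairs realised as unit distances of `q` injects into the contacts
  have hcount : ∀ F : Finset (Fin 12 × Fin 12), (∀ e ∈ F, e.1 ≠ e.2) →
      (∀ e ∈ F, ‖q e.1 - q e.2‖ = 1) →
      F.card ≤ ((Z ×ˢ Z).filter fun w : EuclideanSpace ℝ (Fin 3) × EuclideanSpace ℝ (Fin 3) =>
        dist w.1 w.2 = 1).card := by
    intro F hF hF1
    refine Finset.card_le_card_of_injOn (fun e => (q e.1, q e.2)) ?_ ?_
    · intro e he
      simp only [coe_filter, mem_product, Set.mem_setOf_eq, hZ, mem_image, mem_univ, true_and,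
        exists_apply_eq_apply, and_self]
      rw [dist_eq_norm]
      exact hF1 e he
    · intro e _ e' _ hee'
      simp only [Prod.mk.injEq] at hee'
      exact Prod.ext (hinj hee'.1) (hinj hee'.2)
  have hEexact : ∀ e ∈ E, ‖q e.1 - q e.2‖ = 1 := fun e he =>
    le_antisymm (hq3 e he) (hq2 _ _ ((mem_filter.1 he).2.1))
  have hZ48 : ((Z ×ˢ Z).filter fun w : EuclideanSpace ℝ (Fin 3) × EuclideanSpace ℝ (Fin 3) =>
      dist w.1 w.2 = 1).card = 48 :=
    le_antisymm h48Z (le_trans h48 (hcount E (fun e he => (mem_filter.1 he).2.1) hEexact))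
  obtain ⟨A, hA⟩ := hcase hZ48
  -- the contact set of `q` is exactly `E`
  have hiff : ∀ i j, i ≠ j → ((i, j) ∈ E ↔ ‖q i - q j‖ = 1) := by
    intro i j hij
    refine ⟨fun h => hEexact (i, j) h, fun h => ?_⟩
    by_contra hnot
    have hF : ∀ e ∈ insert (i, j) E, e.1 ≠ e.2 := by
      intro e he
      rcases mem_insert.1 he with rfl | he
      · exact hij
      · exact (mem_filter.1 he).2.1
    have hF1 : ∀ e ∈ insert (i, j) E, ‖q e.1 - q e.2‖ = 1 := by
      intro e he
      rcases mem_insert.1 he with rfl | he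
      · exact h
      · exact hEexact e he
    have h49 := hcount (insert (i, j) E) hF hF1
    rw [card_insert_of_notMem hnot, hZ48] at h49
    omega
  -- the pattern and the enumeration `η = A⁻¹ ∘ q`
  obtain ⟨P, hP, hZP⟩ : ∃ P : Finset (EuclideanSpace ℝ (Fin 3)),
      (P = Literature.Geometry.DiscreteGeometry.fccKissingPattern ∨
        P = Literature.Geometry.DiscreteGeometry.hcpKissingPattern) ∧ Z = P.image A := by
    rcases hA with h | h
    · exact ⟨_, Or.inl rfl, h⟩
    · exact ⟨_, Or.inr rfl, h⟩
  have hPcard : P.card = 12 := by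
    rcases hP with rfl | rfl
    · exact Literature.Geometry.DiscreteGeometry.card_fccKissingPattern
    · exact Literature.Geometry.DiscreteGeometry.card_hcpKissingPattern
  have hmem : ∀ i, q i ∈ P.image A := by
    intro i
    rw [← hZP]
    exact mem_image_of_mem q (mem_univ i)
  choose η hηP hηq using fun i => mem_image.1 (hmem i)
  have hηinj : Function.Injective η := fun i j h => hinj (by rw [← hηq i, ← hηq j, h])
  refine ⟨P, A, η, hP, ?_, hηinj, fun i => ?_, fun i j hij => ?_⟩
  · apply Finset.eq_of_subset_of_card_le
    · intro v hv
      obtain ⟨i, -, rfl⟩ := mem_image.1 hv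
      exact hηP i
    · rw [card_image_of_injective _ hηinj, card_univ, Fintype.card_fin, hPcard]
  · rw [hηq]; exact hq4 i
  · have hd : dist (η i) (η j) = ‖q i - q j‖ := by
      rw [dist_eq_norm, ← hηq i, ← hηq j, ← map_sub, A.norm_map]
    rw [hd, ← hiff i j hij]
    simp only [hEdef, mem_filter, mem_univ, true_and]
    exact ⟨fun h => ⟨hij, h⟩, fun h => h.2⟩

/-- **Proposition 3.3.2, AS PRINTED up to the packaging of `ε(α)` (modulo Theorem 3.5 = `h35`).**
"If `½ #𝒜(x) = 24`, then `#N(x) = 12` and there exists `Q ∈ {Cub, TCub}`, a map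
`Φ : Q ∪ {0} → N(x) ∪ {x}` and a monotone function `ε : ℝ → ℝ` such that `lim_{α→0} ε(α) = 0`
and `(Φ(η), Φ(η′)) ∈ 𝒩` if and only if `η, η′ ∈ Q ∪ {0}` and `|η − η′| = 1`,
`min_{R ∈ SO(3)} max_{η ∈ Q ∪ {0}} |R η + y(x) − y ∘ Φ(η)| ≤ ε(α)`." Rendered in `δ`-form (the
content of "monotone `ε` with `ε(α) → 0`": for every `δ > 0` the deviation is `< δ` once
`α < α₀(δ)`): for every `δ > 0` there is `α₀ > 0` such that for all `α < α₀`, every finite `X`,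
every `y : X → ℝ³` with (eq:mindist) and every `x` with `#𝒜(x) ≥ 48`: `#N(x) = 12`, and there are
`Q = fccKissingPattern` (`Cub`) or `hcpKissingPattern` (`TCub`), a linear isometry `R` of `ℝ³`
and `Φ : ℝ³ → X` with `Φ(0) = x`, `Φ(Q) ⊆ N(x)`, `Φ` injective on `Q ∪ {0}`, the bond
equivalence `(Φ η, Φ η′) ∈ 𝒩 ↔ |η − η′| = 1` on `Q ∪ {0}`, and `|R η + y(x) − y(Φ η)| < δ` on
`Q ∪ {0}`. (`R` is a linear isometry, i.e. in `O(3)`; the printed `SO(3)` follows because `Cub` is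
centrally symmetric and `TCub` has a mirror plane — not formalized here, as in
`KissingContactMaximum.lean`.) Proof: `exists_card_nbhd_eq_twelve_of_pairs` + indexing `N(x)` by
`Fin 12` + `exists_close_pattern_of_contactPairs` + bookkeeping.
[cite: FlatleyTheil2015, Proposition 3.3.2 (arXiv p. 9) with its proof (Theorems 3.4, 3.5 +
compactness)] -/
theorem exists_localChart (h35 : FlatleyEtAl2013_maxContacts) {δ : ℝ} (hδ : 0 < δ) :
    ∃ α₀ : ℝ, 0 < α₀ ∧ ∀ α : ℝ, α < α₀ →
      ∀ {X : Type*} [Fintype X] [DecidableEq X] (y : X → EuclideanSpace ℝ (Fin 3)),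
      (∀ x x', x ≠ x' → 1 - α < ‖y x' - y x‖) → ∀ x,
      48 ≤ (((univ.filter fun x' => |‖y x' - y x‖ - 1| ≤ α) ×ˢ
          (univ.filter fun x' => |‖y x' - y x‖ - 1| ≤ α)).filter
          fun q => |‖y q.2 - y q.1‖ - 1| ≤ α).card →
      (univ.filter fun x' => |‖y x' - y x‖ - 1| ≤ α).card = 12 ∧
      ∃ (Q : Finset (EuclideanSpace ℝ (Fin 3)))
        (R : EuclideanSpace ℝ (Fin 3) →ₗᵢ[ℝ] EuclideanSpace ℝ (Fin 3))
        (Φ : EuclideanSpace ℝ (Fin 3) → X),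
        (Q = Literature.Geometry.DiscreteGeometry.fccKissingPattern ∨
          Q = Literature.Geometry.DiscreteGeometry.hcpKissingPattern) ∧
        Φ 0 = x ∧ (∀ η ∈ Q, |‖y (Φ η) - y x‖ - 1| ≤ α) ∧
        Set.InjOn Φ ↑(insert (0 : EuclideanSpace ℝ (Fin 3)) Q) ∧
        (∀ η ∈ insert (0 : EuclideanSpace ℝ (Fin 3)) Q,
          ∀ η' ∈ insert (0 : EuclideanSpace ℝ (Fin 3)) Q,
          (|‖y (Φ η') - y (Φ η)‖ - 1| ≤ α ↔ dist η η' = 1)) ∧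
        (∀ η ∈ insert (0 : EuclideanSpace ℝ (Fin 3)) Q, ‖R η + y x - y (Φ η)‖ < δ) := by
  classical
  obtain ⟨α₁, hα₁, h12⟩ := exists_card_nbhd_eq_twelve_of_pairs h35
  obtain ⟨α₂, hα₂, hclose⟩ := exists_close_pattern_of_contactPairs h35 hδ
  refine ⟨min α₁ (min α₂ 1), lt_min hα₁ (lt_min hα₂ one_pos), ?_⟩
  intro α hα X _ _ y hsep x h48
  have hα₁' : α < α₁ := hα.trans_le (min_le_left _ _)
  have hα₂' : α < α₂ := (hα.trans_le (min_le_right _ _)).trans_le (min_le_left _ _)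
  have hα1 : α < 1 := (hα.trans_le (min_le_right _ _)).trans_le (min_le_right _ _)
  set N := (univ.filter fun x' => |‖y x' - y x‖ - 1| ≤ α : Finset X) with hN
  have hN12 : N.card = 12 := h12 α hα₁' y hsep x h48
  refine ⟨hN12, ?_⟩
  -- `x ∉ N(x)` and members of `N(x)` differ from `x`
  have hxN : ∀ a ∈ N, a ≠ x := by
    intro a ha hax
    have h := (mem_filter.1 ha).2
    rw [hax, sub_self, norm_zero] at h
    have := abs_le.1 h
    linarith
  -- index `N(x)` by `Fin 12`
  let e := N.equivFinOfCardEq hN12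
  let lab : Fin 12 → X := fun i => (e.symm i : X)
  have hlabN : ∀ i, lab i ∈ N := fun i => (e.symm i).2
  have hlabinj : Function.Injective lab := fun i j h => e.symm.injective (Subtype.ext h)
  let p : Fin 12 → EuclideanSpace ℝ (Fin 3) := fun i => y (lab i) - y x
  have hp1 : ∀ i, |‖p i‖ - 1| ≤ α := fun i => (mem_filter.1 (hlabN i)).2
  have hp2 : ∀ i j, i ≠ j → 1 - α ≤ ‖p i - p j‖ := by
    intro i j hij
    have hne : lab i ≠ lab j := fun h => hij (hlabinj h)
    have := hsep (lab j) (lab i) hne.symm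
    rw [show p i - p j = y (lab i) - y (lab j) by simp only [p]; abel]
    exact this.le
  -- the realised contact pattern has `≥ 48` pairs
  have hE48 : 48 ≤ (univ.filter fun q : Fin 12 × Fin 12 =>
      q.1 ≠ q.2 ∧ ‖p q.1 - p q.2‖ ≤ 1 + α).card := by
    refine le_trans h48 (le_of_eq ?_)
    refine Finset.card_bij' (fun q hq => (e ⟨q.1, (mem_product.1 (mem_filter.1 hq).1).1⟩,
        e ⟨q.2, (mem_product.1 (mem_filter.1 hq).1).2⟩))
      (fun r _ => (lab r.1, lab r.2)) ?_ ?_ ?_ ?_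
    · intro q hq
      obtain ⟨⟨hq1, hq2⟩, hd⟩ := mem_filter.1 hq |>.imp_left mem_product.1
      simp only [mem_filter, mem_univ, true_and]
      refine ⟨fun h => ?_, ?_⟩
      · have h' : q.1 = q.2 := Subtype.ext_iff.1 (e.injective h)
        rw [h', sub_self, norm_zero] at hd
        have := abs_le.1 hd; linarith
      · simp only [p, lab, Equiv.symm_apply_apply]
        rw [show y q.1 - y x - (y q.2 - y x) = y q.1 - y q.2 by abel, norm_sub_rev]
        have := (abs_le.1 hd).2; linarith
    · intro r hr
      obtain ⟨hne, hd⟩ := (mem_filter.1 hr).2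
      simp only [mem_filter, mem_product]
      refine ⟨⟨hlabN r.1, hlabN r.2⟩, ?_⟩
      have hsep' := hp2 r.1 r.2 hne
      rw [show y (lab r.2) - y (lab r.1) = -(p r.1 - p r.2) by simp only [p]; abel, norm_neg,
        abs_le]
      constructor <;> linarith
    · intro q hq
      simp only [lab, Equiv.symm_apply_apply, Prod.mk.eta]
    · intro r hr
      simp only [lab, Subtype.coe_eta, Equiv.apply_symm_apply, Prod.mk.eta]
  obtain ⟨Q, A, η, hQ, hηQ, hηinj, hηclose, hηiff⟩ := hclose α hα₂' p hp1 hp2 hE48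
  have hηmem : ∀ i, η i ∈ Q := fun i => hηQ ▸ mem_image_of_mem η (mem_univ i)
  have hηnorm : ∀ i, ‖η i‖ = 1 := by
    intro i
    rcases hQ with rfl | rfl
    · exact Literature.Geometry.DiscreteGeometry.norm_eq_one_of_mem_fccKissingPattern (hηmem i)
    · exact Literature.Geometry.DiscreteGeometry.norm_eq_one_of_mem_hcpKissingPattern (hηmem i)
  have hη0 : ∀ i, η i ≠ 0 := fun i h => by
    have := hηnorm i; rw [h, norm_zero] at this; exact zero_ne_one this
  -- the chart
  let Φ : EuclideanSpace ℝ (Fin 3) → X := fun v =>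
    if ∃ i, η i = v then lab (Function.invFun η v) else x
  have hΦ0 : Φ 0 = x := by
    simp only [Φ]
    rw [if_neg]
    rintro ⟨i, hi⟩
    exact hη0 i hi
  have hΦη : ∀ i, Φ (η i) = lab i := by
    intro i
    simp only [Φ]
    rw [if_pos ⟨i, rfl⟩, Function.leftInverse_invFun hηinj i]
  have hmemQ : ∀ v ∈ Q, ∃ i, η i = v := by
    intro v hv
    rw [← hηQ] at hv
    obtain ⟨i, -, rfl⟩ := mem_image.1 hv
    exact ⟨i, rfl⟩
  refine ⟨Q, A, Φ, hQ, hΦ0, ?_, ?_, ?_, ?_⟩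
  · -- `Φ(Q) ⊆ N(x)`
    intro v hv
    obtain ⟨i, rfl⟩ := hmemQ v hv
    rw [hΦη]
    exact (mem_filter.1 (hlabN i)).2
  · -- injective on `Q ∪ {0}`
    intro v hv w hw hvw
    rw [Finset.coe_insert, Set.mem_insert_iff, Finset.mem_coe] at hv hw
    rcases hv with rfl | hv <;> rcases hw with rfl | hw
    · rfl
    · obtain ⟨j, rfl⟩ := hmemQ w hw
      rw [hΦ0, hΦη] at hvw
      exact absurd hvw.symm (hxN _ (hlabN j))
    · obtain ⟨i, rfl⟩ := hmemQ v hv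
      rw [hΦ0, hΦη] at hvw
      exact absurd hvw (hxN _ (hlabN i))
    · obtain ⟨i, rfl⟩ := hmemQ v hv
      obtain ⟨j, rfl⟩ := hmemQ w hw
      rw [hΦη, hΦη] at hvw
      rw [hlabinj hvw]
  · -- the bond equivalence
    intro v hv w hw
    rw [Finset.mem_insert] at hv hw
    rcases hv with rfl | hv <;> rcases hw with rfl | hw
    · rw [hΦ0, sub_self, norm_zero, dist_self]
      constructor
      · intro h; have := abs_le.1 h; linarith
      · intro h; exact absurd h zero_ne_one
    · obtain ⟨j, rfl⟩ := hmemQ w hw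
      rw [hΦ0, hΦη, dist_eq_norm, zero_sub, norm_neg, hηnorm]
      exact ⟨fun _ => rfl, fun _ => (mem_filter.1 (hlabN j)).2⟩
    · obtain ⟨i, rfl⟩ := hmemQ v hv
      rw [hΦ0, hΦη, dist_eq_norm, sub_zero, hηnorm, norm_sub_rev]
      exact ⟨fun _ => rfl, fun _ => (mem_filter.1 (hlabN i)).2⟩
    · obtain ⟨i, rfl⟩ := hmemQ v hv
      obtain ⟨j, rfl⟩ := hmemQ w hw
      rw [hΦη, hΦη]
      by_cases hij : i = j
      · subst hij
        rw [sub_self, norm_zero, dist_self]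
        constructor
        · intro h; have := abs_le.1 h; linarith
        · intro h; exact absurd h zero_ne_one
      · rw [← hηiff i j hij, show y (lab j) - y (lab i) = -(p i - p j) by simp only [p]; abel,
          norm_neg, abs_le]
        have hs := hp2 i j hij
        constructor
        · intro h; linarith [h.2]
        · intro h; constructor <;> linarith
  · -- closeness
    intro v hv
    rw [Finset.mem_insert] at hv
    rcases hv with rfl | hv
    · rw [map_zero, zero_add, hΦ0, sub_self, norm_zero]; exact hδ
    · obtain ⟨i, rfl⟩ := hmemQ v hv
      rw [hΦη, show A (η i) + y x - y (lab i) = -(p i - A (η i)) by simp only [p]; abel,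
        norm_neg]
      exact hηclose i

/-! ### The rotation may be taken in `SO(3)`: both patterns have an orientation-reversing symmetry
-/

/-- `intVec (−v) = −intVec v`. [folklore] -/
private theorem intVec_neg (v : Fin 3 → ℤ) :
    Literature.Geometry.DiscreteGeometry.intVec (-v) =
      -Literature.Geometry.DiscreteGeometry.intVec v := by
  ext i; simp [Literature.Geometry.DiscreteGeometry.intVec]

/-- The cuboctahedron is centrally symmetric (integer model). [folklore] -/
private theorem neg_mem_fccInt' : ∀ v ∈ Literature.Geometry.DiscreteGeometry.fccInt,
    -v ∈ Literature.Geometry.DiscreteGeometry.fccInt := by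
  decide

/-- `−Cub ⊆ Cub`: the point reflection `−id` (determinant `−1` on `ℝ³`) preserves the cuboctahedron.
[cite: FlatleyTheil2015, §3.1.1 (Cub = 𝓛_fcc ∩ 𝕊, a lattice is centrally symmetric)] -/
theorem neg_mem_fccKissingPattern {v : EuclideanSpace ℝ (Fin 3)}
    (hv : v ∈ Literature.Geometry.DiscreteGeometry.fccKissingPattern) :
    -v ∈ Literature.Geometry.DiscreteGeometry.fccKissingPattern := by
  simp only [Literature.Geometry.DiscreteGeometry.fccKissingPattern,
    Literature.Geometry.DiscreteGeometry.scaledPattern, Finset.mem_image] at hv ⊢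
  obtain ⟨w, hw, rfl⟩ := hv
  exact ⟨-w, neg_mem_fccInt' w hw, by rw [intVec_neg, smul_neg]⟩

/-- The integer model of the mirror of `TCub`: `v ↦ v − (2(v₀+v₁+v₂)/3)(1,1,1)`, the reflection of
`ℤ³` in the hexagonal mid-plane `x + y + z = 0` (exact on `hcpInt`, where `v₀+v₁+v₂ ∈ {0, ±6}`).
[cite: HalesDSP2012, §1.3 ("a uniquely determined plane of reflectional symmetry")] -/
private def mirrorInt (v : Fin 3 → ℤ) : Fin 3 → ℤ :=
  ![v 0 - 2 * (v 0 + v 1 + v 2) / 3, v 1 - 2 * (v 0 + v 1 + v 2) / 3,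
    v 2 - 2 * (v 0 + v 1 + v 2) / 3]

/-- On `hcpInt` the division in `mirrorInt` is exact. [folklore] -/
private theorem mirrorInt_exact : ∀ v ∈ Literature.Geometry.DiscreteGeometry.hcpInt,
    3 * (2 * (v 0 + v 1 + v 2) / 3) = 2 * (v 0 + v 1 + v 2) := by
  decide

/-- The mirror maps `hcpInt` into itself. [cite: HalesDSP2012, §1.3] -/
private theorem mirrorInt_mem : ∀ v ∈ Literature.Geometry.DiscreteGeometry.hcpInt,
    mirrorInt v ∈ Literature.Geometry.DiscreteGeometry.hcpInt := by
  decide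

/-- The normal `n = (1, 1, 1)` of the hexagonal mid-plane of `TCub`. [folklore] -/
private def hexNormal : EuclideanSpace ℝ (Fin 3) :=
  Literature.Geometry.DiscreteGeometry.intVec ![1, 1, 1]

/-- The mirror of `ℝ³` in the plane `n^⊥`, `n = (1,1,1)`: a linear isometry of determinant `−1`
mapping the twisted cuboctahedron `TCub` into itself.
[cite: HalesDSP2012, §1.3 ("a uniquely determined plane of reflectional symmetry, containing six
of the twelve points")] -/
theorem exists_mirror_hcpKissingPattern :
    ∃ g : EuclideanSpace ℝ (Fin 3) ≃ₗᵢ[ℝ] EuclideanSpace ℝ (Fin 3),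
      LinearMap.det (g.toLinearEquiv : EuclideanSpace ℝ (Fin 3) →ₗ[ℝ] EuclideanSpace ℝ (Fin 3)) =
        -1 ∧
      ∀ v ∈ Literature.Geometry.DiscreteGeometry.hcpKissingPattern,
        g v ∈ Literature.Geometry.DiscreteGeometry.hcpKissingPattern := by
  have hn0 : hexNormal ≠ 0 := by
    intro h
    have := congrArg (fun x : EuclideanSpace ℝ (Fin 3) => x 0) h
    simp [hexNormal, Literature.Geometry.DiscreteGeometry.intVec] at this
  refine ⟨(ℝ ∙ hexNormal)ᗮ.reflection, ?_, ?_⟩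
  · have h := Submodule.det_reflection (K := (ℝ ∙ hexNormal)ᗮ)
    rw [Submodule.orthogonal_orthogonal, finrank_span_singleton hn0, pow_one] at h
    exact h
  · intro v hv
    simp only [Literature.Geometry.DiscreteGeometry.hcpKissingPattern,
      Literature.Geometry.DiscreteGeometry.scaledPattern, Finset.mem_image] at hv ⊢
    obtain ⟨w, hw, rfl⟩ := hv
    refine ⟨mirrorInt w, mirrorInt_mem w hw, ?_⟩
    rw [LinearIsometryEquiv.map_smul, Submodule.reflection_orthogonal_apply,
      Submodule.reflection_singleton_apply]
    -- compute the inner product and the norm of `n`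
    have hinner : @inner ℝ _ _ hexNormal (Literature.Geometry.DiscreteGeometry.intVec w) =
        ((w 0 + w 1 + w 2 : ℤ) : ℝ) := by
      simp [hexNormal, Literature.Geometry.DiscreteGeometry.intVec, PiLp.inner_apply,
        Fin.sum_univ_three]
    have hnorm : ‖hexNormal‖ ^ 2 = 3 := by
      have h3 : (Literature.Geometry.DiscreteGeometry.sqNormInt ![1, 1, 1] : ℝ) = 3 := by
        norm_num [Literature.Geometry.DiscreteGeometry.sqNormInt, Matrix.cons_val_two,
          Matrix.tail_cons, Matrix.head_cons]
      rw [hexNormal, Literature.Geometry.DiscreteGeometry.norm_intVec, h3,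
        Real.sq_sqrt (by norm_num)]
    rw [hinner]
    simp only [RCLike.ofReal_real_eq_id, id_eq]
    rw [hnorm]
    have hk : ((2 * (w 0 + w 1 + w 2) / 3 : ℤ) : ℝ) = 2 * ((w 0 + w 1 + w 2 : ℤ) : ℝ) / 3 := by
      have h3 := mirrorInt_exact w hw
      have h3' : ((3 * (2 * (w 0 + w 1 + w 2) / 3) : ℤ) : ℝ) =
          ((2 * (w 0 + w 1 + w 2) : ℤ) : ℝ) := by
        exact_mod_cast h3
      push_cast at h3' ⊢
      linarith
    congr 1
    ext i
    fin_cases i <;>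
      simp [mirrorInt, hexNormal, Literature.Geometry.DiscreteGeometry.intVec, hk] <;> ring

/-- For either pattern there is an orientation-reversing linear isometry mapping it into itself
(`−id` for `Cub`, the hexagonal mirror for `TCub`); hence `O(3)`- and `SO(3)`-orbits of the
patterns agree. [cite: FlatleyTheil2015, §3.1.1] [cite: HalesDSP2012, §1.3] -/
theorem exists_detNegOne_symmetry {Q : Finset (EuclideanSpace ℝ (Fin 3))}
    (hQ : Q = Literature.Geometry.DiscreteGeometry.fccKissingPattern ∨
      Q = Literature.Geometry.DiscreteGeometry.hcpKissingPattern) :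
    ∃ g : EuclideanSpace ℝ (Fin 3) ≃ₗᵢ[ℝ] EuclideanSpace ℝ (Fin 3),
      LinearMap.det (g.toLinearEquiv : EuclideanSpace ℝ (Fin 3) →ₗ[ℝ] EuclideanSpace ℝ (Fin 3)) =
        -1 ∧
      ∀ v ∈ Q, g v ∈ Q := by
  rcases hQ with rfl | rfl
  · refine ⟨LinearIsometryEquiv.neg ℝ, ?_, fun v hv => ?_⟩
    · have hneg : ((LinearIsometryEquiv.neg ℝ :
          EuclideanSpace ℝ (Fin 3) ≃ₗᵢ[ℝ] EuclideanSpace ℝ (Fin 3)).toLinearEquiv :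
          EuclideanSpace ℝ (Fin 3) →ₗ[ℝ] EuclideanSpace ℝ (Fin 3)) = (-1 : ℝ) • LinearMap.id := by
        ext x; simp
      rw [hneg, LinearMap.det_smul, LinearMap.det_id, finrank_euclideanSpace_fin]
      norm_num
    · simpa using neg_mem_fccKissingPattern hv
  · exact exists_mirror_hcpKissingPattern

/-- A linear isometry of `ℝ³` has determinant `±1`. [folklore] -/
private theorem abs_det_linearIsometry'
    (A : EuclideanSpace ℝ (Fin 3) →ₗᵢ[ℝ] EuclideanSpace ℝ (Fin 3)) :
    |LinearMap.det A.toLinearMap| = 1 := by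
  rw [← LinearMap.normDet_eq_abs_det]
  exact A.normDet_eq_one

/-- **Proposition 3.3.2 with the rotation in `SO(3)`, as printed** (modulo Theorem 3.5 = `h35`):
the statement of `exists_localChart` with `R` a linear isometry of determinant `1`. If the chart
from `exists_localChart` has `det R = −1`, precompose `R` and `Φ` with the orientation-reversing
symmetry of `Q` (`exists_detNegOne_symmetry`).
[cite: FlatleyTheil2015, Proposition 3.3.2 ("a rotation R ∈ SO(3)")] -/
theorem exists_localChart_detOne (h35 : FlatleyEtAl2013_maxContacts) {δ : ℝ} (hδ : 0 < δ) :
    ∃ α₀ : ℝ, 0 < α₀ ∧ ∀ α : ℝ, α < α₀ →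
      ∀ {X : Type*} [Fintype X] [DecidableEq X] (y : X → EuclideanSpace ℝ (Fin 3)),
      (∀ x x', x ≠ x' → 1 - α < ‖y x' - y x‖) → ∀ x,
      48 ≤ (((univ.filter fun x' => |‖y x' - y x‖ - 1| ≤ α) ×ˢ
          (univ.filter fun x' => |‖y x' - y x‖ - 1| ≤ α)).filter
          fun q => |‖y q.2 - y q.1‖ - 1| ≤ α).card →
      (univ.filter fun x' => |‖y x' - y x‖ - 1| ≤ α).card = 12 ∧
      ∃ (Q : Finset (EuclideanSpace ℝ (Fin 3)))
        (R : EuclideanSpace ℝ (Fin 3) →ₗᵢ[ℝ] EuclideanSpace ℝ (Fin 3))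
        (Φ : EuclideanSpace ℝ (Fin 3) → X),
        (Q = Literature.Geometry.DiscreteGeometry.fccKissingPattern ∨
          Q = Literature.Geometry.DiscreteGeometry.hcpKissingPattern) ∧
        LinearMap.det R.toLinearMap = 1 ∧
        Φ 0 = x ∧ (∀ η ∈ Q, |‖y (Φ η) - y x‖ - 1| ≤ α) ∧
        Set.InjOn Φ ↑(insert (0 : EuclideanSpace ℝ (Fin 3)) Q) ∧
        (∀ η ∈ insert (0 : EuclideanSpace ℝ (Fin 3)) Q,
          ∀ η' ∈ insert (0 : EuclideanSpace ℝ (Fin 3)) Q,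
          (|‖y (Φ η') - y (Φ η)‖ - 1| ≤ α ↔ dist η η' = 1)) ∧
        (∀ η ∈ insert (0 : EuclideanSpace ℝ (Fin 3)) Q, ‖R η + y x - y (Φ η)‖ < δ) := by
  obtain ⟨α₀, hα₀, h⟩ := exists_localChart h35 hδ
  refine ⟨α₀, hα₀, ?_⟩
  intro α hα X _ _ y hsep x h48
  obtain ⟨h12, Q, R, Φ, hQ, hΦ0, hΦN, hinj, hiff, hclose⟩ := h α hα y hsep x h48
  refine ⟨h12, ?_⟩
  rcases (abs_eq (zero_le_one' ℝ)).1 (abs_det_linearIsometry' R) with hdet | hdet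
  · exact ⟨Q, R, Φ, hQ, hdet, hΦ0, hΦN, hinj, hiff, hclose⟩
  obtain ⟨g, hgdet, hgQ⟩ := exists_detNegOne_symmetry hQ
  have hg0 : ∀ v, v ∈ insert (0 : EuclideanSpace ℝ (Fin 3)) Q →
      g v ∈ insert (0 : EuclideanSpace ℝ (Fin 3)) Q := by
    intro v hv
    rcases Finset.mem_insert.1 hv with rfl | hv
    · rw [map_zero]; exact Finset.mem_insert_self _ _
    · exact Finset.mem_insert_of_mem (hgQ v hv)
  refine ⟨Q, R.comp g.toLinearIsometry, Φ ∘ g, hQ, ?_, ?_, ?_, ?_, ?_, ?_⟩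
  · have hcomp : (R.comp g.toLinearIsometry).toLinearMap =
        R.toLinearMap.comp
          (g.toLinearEquiv : EuclideanSpace ℝ (Fin 3) →ₗ[ℝ] EuclideanSpace ℝ (Fin 3)) := rfl
    rw [hcomp, LinearMap.det_comp, hdet, hgdet]; norm_num
  · simp only [Function.comp_apply, map_zero, hΦ0]
  · intro η hη
    exact hΦN _ (hgQ η hη)
  · intro v hv w hw hvw
    have hv' : g v ∈ insert (0 : EuclideanSpace ℝ (Fin 3)) Q := hg0 v (by simpa using hv)
    have hw' : g w ∈ insert (0 : EuclideanSpace ℝ (Fin 3)) Q := hg0 w (by simpa using hw)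
    exact g.injective (hinj (by simpa using hv') (by simpa using hw') hvw)
  · intro η hη η' hη'
    rw [Function.comp_apply, Function.comp_apply, hiff _ (hg0 η hη) _ (hg0 η' hη'), g.dist_map]
  · intro η hη
    have := hclose _ (hg0 η hη)
    simpa [Function.comp_apply] using this

/-! ### The local chart in the `ShellCloseTo` vocabulary of `KissingPatterns.lean`

The routes TwoCentreKissing / SoftAnnulusKernel count soft contacts as the `Nat.card` of a subtype
of `T × T` and phrase closeness as `ShellCloseTo δ T fccKissingPattern ∨ ShellCloseTo δ T
hcpKissingPattern`; the following restates Proposition 3.3.2 (modulo `h35`) in that convention.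
Only the INEFFECTIVE `η₀(δ)` of the printed compactness argument is obtained — no numerical
constants (the routes' `η ≤ 1/1000`, `δ = 1/10` are not claimed here). -/

/-- Counting conventions agree: the `Nat.card` of the subtype of ordered pairs of distinct points of
`T` at distance `≤ 1 + η` is the cardinality of the corresponding filtered `Finset`. [folklore] -/
private theorem natCard_softPairs_eq (T : Finset (EuclideanSpace ℝ (Fin 3))) (η : ℝ) :
    Nat.card {q : ↥T × ↥T // q.1 ≠ q.2 ∧ dist (q.1 : EuclideanSpace ℝ (Fin 3)) q.2 ≤ 1 + η} =
      ((T ×ˢ T).filter fun q => q.1 ≠ q.2 ∧ dist q.1 q.2 ≤ 1 + η).card := by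
  classical
  rw [← Nat.card_eq_finsetCard]
  refine Nat.card_congr
    { toFun := fun q =>
        ⟨((q.1.1 : EuclideanSpace ℝ (Fin 3)), (q.1.2 : EuclideanSpace ℝ (Fin 3))),
          mem_filter.2 ⟨mem_product.2 ⟨q.1.1.2, q.1.2.2⟩, fun h => q.2.1 (Subtype.ext h), q.2.2⟩⟩
      invFun := fun p =>
        ⟨(⟨p.1.1, (mem_product.1 (mem_filter.1 p.2).1).1⟩,
            ⟨p.1.2, (mem_product.1 (mem_filter.1 p.2).1).2⟩),
          fun h => (mem_filter.1 p.2).2.1 (congrArg Subtype.val h), (mem_filter.1 p.2).2.2⟩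
      left_inv := fun q => rfl
      right_inv := fun p => rfl }

/-- **Proposition 3.3.2 in the vocabulary of `KissingPatterns.lean`, modulo Theorem 3.5 = `h35`
(the INEFFECTIVE form of the route statement `RobustTangencyBound`):** for every `δ > 0` there is
`η₀ > 0` such that for all `η < η₀`, every finite `T ⊂ ℝ³` with norms in `[1 − η, 1 + η]`,
pairwise distances `≥ 1 − η` and at least `48` ordered pairs of distinct points at distance
`≤ 1 + η` (`Nat.card` convention) satisfies
`ShellCloseTo δ T fccKissingPattern ∨ ShellCloseTo δ T hcpKissingPattern`, i.e. is `δ`-matched to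
the cuboctahedron or to the twisted cuboctahedron after a linear isometry. The printed proof gives
no rate ("standard compactness arguments"), and none is claimed.
[cite: FlatleyTheil2015, Proposition 3.3.2 with its proof, p. 9] -/
theorem exists_shellCloseTo_of_softContacts (h35 : FlatleyEtAl2013_maxContacts) {δ : ℝ}
    (hδ : 0 < δ) :
    ∃ η₀ : ℝ, 0 < η₀ ∧ ∀ η : ℝ, η < η₀ → ∀ T : Finset (EuclideanSpace ℝ (Fin 3)),
      (∀ v ∈ T, 1 - η ≤ ‖v‖ ∧ ‖v‖ ≤ 1 + η) → (∀ v ∈ T, ∀ w ∈ T, v ≠ w → 1 - η ≤ dist v w) →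
      48 ≤ Nat.card {q : ↥T × ↥T //
        q.1 ≠ q.2 ∧ dist (q.1 : EuclideanSpace ℝ (Fin 3)) q.2 ≤ 1 + η} →
      Literature.Geometry.DiscreteGeometry.ShellCloseTo δ T
          Literature.Geometry.DiscreteGeometry.fccKissingPattern ∨
        Literature.Geometry.DiscreteGeometry.ShellCloseTo δ T
          Literature.Geometry.DiscreteGeometry.hcpKissingPattern := by
  classical
  obtain ⟨α₁, hα₁, h12⟩ := exists_card_eq_twelve_of_contactPairs_annulus h35
  obtain ⟨α₂, hα₂, hclose⟩ := exists_close_pattern_of_contactPairs h35 hδ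
  refine ⟨min α₁ α₂, lt_min hα₁ hα₂, fun η hη T hT1 hT2 h48 => ?_⟩
  have hη₁ : η < α₁ := hη.trans_le (min_le_left _ _)
  have hη₂ : η < α₂ := hη.trans_le (min_le_right _ _)
  rw [natCard_softPairs_eq] at h48
  have hT1' : ∀ v ∈ T, |‖v‖ - 1| ≤ η := fun v hv => by
    rw [abs_le]; constructor <;> linarith [(hT1 v hv).1, (hT1 v hv).2]
  have hk : T.card = 12 := h12 η hη₁ T hT1' hT2 h48
  -- index `T` by `Fin 12`
  let e := T.equivFinOfCardEq hk
  let p : Fin 12 → EuclideanSpace ℝ (Fin 3) := fun j => (e.symm j : EuclideanSpace ℝ (Fin 3))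
  have hpinj : Function.Injective p := fun j j' h => e.symm.injective (Subtype.ext h)
  have hp1 : ∀ i, |‖p i‖ - 1| ≤ η := fun i => hT1' _ (e.symm i).2
  have hp2 : ∀ i j, i ≠ j → 1 - η ≤ ‖p i - p j‖ := by
    intro i j hij
    have := hT2 _ (e.symm i).2 _ (e.symm j).2 (fun h => hij (hpinj h))
    rwa [dist_eq_norm] at this
  have hE : 48 ≤ (univ.filter fun q : Fin 12 × Fin 12 =>
      q.1 ≠ q.2 ∧ ‖p q.1 - p q.2‖ ≤ 1 + η).card := by
    have hsub : ((T ×ˢ T).filter fun q => q.1 ≠ q.2 ∧ dist q.1 q.2 ≤ 1 + η) ⊆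
        (univ.filter fun q : Fin 12 × Fin 12 => q.1 ≠ q.2 ∧ ‖p q.1 - p q.2‖ ≤ 1 + η).image
          fun q => (p q.1, p q.2) := by
      intro q hq
      simp only [mem_filter, mem_product] at hq
      obtain ⟨⟨hq1, hq2⟩, hne', hd⟩ := hq
      refine mem_image.2 ⟨(e ⟨q.1, hq1⟩, e ⟨q.2, hq2⟩), ?_, ?_⟩
      · simp only [p, mem_filter, mem_univ, true_and, Equiv.symm_apply_apply]
        refine ⟨fun h => hne' (Subtype.ext_iff.1 (e.injective h)), ?_⟩
        rwa [dist_eq_norm] at hd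
      · simp only [p, Equiv.symm_apply_apply, Prod.mk.eta]
    calc 48 ≤ _ := h48
      _ ≤ _ := Finset.card_le_card hsub
      _ ≤ _ := Finset.card_image_le
  obtain ⟨Q, A, ηv, hQ, hηQ, hηinj, hηclose, -⟩ := hclose η hη₂ p hp1 hp2 hE
  have hηmem : ∀ i, ηv i ∈ Q := fun i => hηQ ▸ mem_image_of_mem ηv (mem_univ i)
  have hQcard : Q.card = 12 := by
    rcases hQ with rfl | rfl
    · exact Literature.Geometry.DiscreteGeometry.card_fccKissingPattern
    · exact Literature.Geometry.DiscreteGeometry.card_hcpKissingPattern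
  -- the matching `t ↦ A (η (e t))` is injective between sets of twelve points, hence bijective
  let f : ↥T → ↥(Q.image A) := fun t => ⟨A (ηv (e t)), mem_image_of_mem _ (hηmem _)⟩
  have hfinj : Function.Injective f := by
    intro t t' h
    have h' : A (ηv (e t)) = A (ηv (e t')) := congrArg Subtype.val h
    exact e.injective (hηinj (A.injective h'))
  have hbij : Function.Bijective f := by
    rw [Fintype.bijective_iff_injective_and_card]
    refine ⟨hfinj, ?_⟩
    rw [Fintype.card_coe, Fintype.card_coe, card_image_of_injective _ A.injective, hk, hQcard]
  have hmatch : Literature.Geometry.DiscreteGeometry.EtaMatched δ T (Q.image A) := by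
    refine ⟨Equiv.ofBijective f hbij, fun t => ?_⟩
    rw [Equiv.ofBijective_apply]
    change dist (t : EuclideanSpace ℝ (Fin 3)) (A (ηv (e t))) ≤ δ
    have ht : (t : EuclideanSpace ℝ (Fin 3)) = p (e t) := by simp [p]
    rw [ht, dist_eq_norm]
    exact (hηclose (e t)).le
  rcases hQ with rfl | rfl
  · exact Or.inl ⟨A, hmatch⟩
  · exact Or.inr ⟨A, hmatch⟩

/-! ### Definition 3.6 (the label classes `X₁₂ ⊇ X_reg ⊇ X_Cub, X_TCub`, `∂X`) and the partition
`X_reg = X_Cub ∪ X_TCub`, `X_Cub ∩ X_TCub = ∅` (the display following Definition 3.6, p. 10)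

As printed: "`X₁₂ = {x ∈ X : #N(x) = 12}`, `X_reg = {x ∈ X₁₂ : ½ #A(x) = 24}`,
`X_Cub = {x ∈ X_reg : (eq:qdist) holds with Q = Cub}`, `X_TCub = {x ∈ X_reg : (eq:qdist) holds
with Q = TCub}`, `∂X = X ∖ X_Cub`. Clearly `X ⊇ X₁₂ ⊇ X_reg`. Proposition 3.3.2 implies that
`X_Cub` and `X_TCub` form a partition of `X_reg`, i.e. `X_reg = X_Cub ∪ X_TCub` and
`X_Cub ∩ X_TCub = ∅` if `α ≤ α₀`." [cite: FlatleyTheil2015, Definition 3.6 and the following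
display, p. 10]

Rendering: the chart condition (eq:qdist) is `HasLocalChart α δ y x Q` — the conjunction delivered
by `exists_localChart_detOne` (with `R ∈ SO(3)`), the printed modulus `ε(α)` being replaced by the
closeness parameter `δ` (PRINT NOTE P332-ε above), so `X_Cub`, `X_TCub`, `∂X` carry `δ`.
`X_reg ⊆ X_Cub ∪ X_TCub` holds for `α < α₀(δ)` (modulo `h35`); the disjointness holds for ALL
`α, δ, δ'` and needs no `h35`: two charts at the same `x` would induce a bijection `TCub → Cub`
preserving unit distances, but the two contact graphs are not isomorphic — in the cuboctahedron
every unit edge has exactly one common unit neighbour (`fccInt_commonNeighbour_unique`, kernel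
decision), in the twisted cuboctahedron the edge `(0,3,−3)/√18, (3,0,−3)/√18` has the two common
neighbours `(3,3,0)/√18`, `(−1,−1,−4)/√18`. -/

section LabelClasses

variable {X : Type*} [Fintype X]

/-- **The local chart (eq:qdist) of Proposition 3.3.2 at the label `x` with pattern `Q`**, in
`δ`-form and with `R ∈ SO(3)`: there are a linear isometry `R` of determinant `1` and
`Φ : ℝ³ → X` with `Φ 0 = x`, `Φ(Q) ⊆ N(x)`, `Φ` injective on `Q ∪ {0}`,
`(Φ η, Φ η') ∈ 𝒩 ↔ |η − η'| = 1` on `Q ∪ {0}`, and `|R η + y(x) − y(Φ η)| < δ` on `Q ∪ {0}` —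
exactly the conjunction produced by `exists_localChart_detOne`.
[cite: FlatleyTheil2015, Proposition 3.3.2 (eq:qdist), p. 9] -/
def HasLocalChart (α δ : ℝ) (y : X → EuclideanSpace ℝ (Fin 3)) (x : X)
    (Q : Finset (EuclideanSpace ℝ (Fin 3))) : Prop :=
  ∃ (R : EuclideanSpace ℝ (Fin 3) →ₗᵢ[ℝ] EuclideanSpace ℝ (Fin 3))
    (Φ : EuclideanSpace ℝ (Fin 3) → X),
    LinearMap.det R.toLinearMap = 1 ∧ Φ 0 = x ∧ (∀ η ∈ Q, |‖y (Φ η) - y x‖ - 1| ≤ α) ∧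
    Set.InjOn Φ ↑(insert (0 : EuclideanSpace ℝ (Fin 3)) Q) ∧
    (∀ η ∈ insert (0 : EuclideanSpace ℝ (Fin 3)) Q,
      ∀ η' ∈ insert (0 : EuclideanSpace ℝ (Fin 3)) Q,
      (|‖y (Φ η') - y (Φ η)‖ - 1| ≤ α ↔ dist η η' = 1)) ∧
    ∀ η ∈ insert (0 : EuclideanSpace ℝ (Fin 3)) Q, ‖R η + y x - y (Φ η)‖ < δ

/-- **`X₁₂ = {x ∈ X : #N(x) = 12}`.** [cite: FlatleyTheil2015, Definition 3.6] -/
def labelsTwelve (α : ℝ) (y : X → EuclideanSpace ℝ (Fin 3)) : Finset X :=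
  univ.filter fun x => (univ.filter fun x' => |‖y x' - y x‖ - 1| ≤ α).card = 12

/-- **`X_reg = {x ∈ X₁₂ : ½ #A(x) = 24}`** (`#A(x) = 48` ordered pairs).
[cite: FlatleyTheil2015, Definition 3.6] -/
def labelsReg (α : ℝ) (y : X → EuclideanSpace ℝ (Fin 3)) : Finset X :=
  (labelsTwelve α y).filter fun x =>
    (((univ.filter fun x' => |‖y x' - y x‖ - 1| ≤ α) ×ˢ
      (univ.filter fun x' => |‖y x' - y x‖ - 1| ≤ α)).filter
      fun q => |‖y q.2 - y q.1‖ - 1| ≤ α).card = 48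

open scoped Classical in
/-- **`X_Cub = {x ∈ X_reg : (eq:qdist) holds with Q = Cub}`** (closeness parameter `δ`).
[cite: FlatleyTheil2015, Definition 3.6] -/
def labelsCub (α δ : ℝ) (y : X → EuclideanSpace ℝ (Fin 3)) : Finset X :=
  (labelsReg α y).filter fun x =>
    HasLocalChart α δ y x Literature.Geometry.DiscreteGeometry.fccKissingPattern

open scoped Classical in
/-- **`X_TCub = {x ∈ X_reg : (eq:qdist) holds with Q = TCub}`** (closeness parameter `δ`).
[cite: FlatleyTheil2015, Definition 3.6] -/
def labelsTcub (α δ : ℝ) (y : X → EuclideanSpace ℝ (Fin 3)) : Finset X :=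
  (labelsReg α y).filter fun x =>
    HasLocalChart α δ y x Literature.Geometry.DiscreteGeometry.hcpKissingPattern

/-- **`∂X = X ∖ X_Cub`** (as printed: every label without an fcc chart, in particular every
`TCub`-centred regular label, is a boundary label). [cite: FlatleyTheil2015, Definition 3.6] -/
def labelsBoundary [DecidableEq X] (α δ : ℝ) (y : X → EuclideanSpace ℝ (Fin 3)) : Finset X :=
  univ \ labelsCub α δ y

/-- Unfolding `X₁₂`. [cite: FlatleyTheil2015, Definition 3.6] -/
theorem mem_labelsTwelve {α : ℝ} {y : X → EuclideanSpace ℝ (Fin 3)} {x : X} :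
    x ∈ labelsTwelve α y ↔ (univ.filter fun x' => |‖y x' - y x‖ - 1| ≤ α).card = 12 := by
  simp [labelsTwelve]

/-- Unfolding `X_reg`. [cite: FlatleyTheil2015, Definition 3.6] -/
theorem mem_labelsReg {α : ℝ} {y : X → EuclideanSpace ℝ (Fin 3)} {x : X} :
    x ∈ labelsReg α y ↔ (univ.filter fun x' => |‖y x' - y x‖ - 1| ≤ α).card = 12 ∧
      (((univ.filter fun x' => |‖y x' - y x‖ - 1| ≤ α) ×ˢ
        (univ.filter fun x' => |‖y x' - y x‖ - 1| ≤ α)).filter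
        fun q => |‖y q.2 - y q.1‖ - 1| ≤ α).card = 48 := by
  simp [labelsReg, labelsTwelve]

/-- Unfolding `X_Cub`. [cite: FlatleyTheil2015, Definition 3.6] -/
theorem mem_labelsCub {α δ : ℝ} {y : X → EuclideanSpace ℝ (Fin 3)} {x : X} :
    x ∈ labelsCub α δ y ↔ x ∈ labelsReg α y ∧
      HasLocalChart α δ y x Literature.Geometry.DiscreteGeometry.fccKissingPattern := by
  classical
  simp [labelsCub]

/-- Unfolding `X_TCub`. [cite: FlatleyTheil2015, Definition 3.6] -/
theorem mem_labelsTcub {α δ : ℝ} {y : X → EuclideanSpace ℝ (Fin 3)} {x : X} :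
    x ∈ labelsTcub α δ y ↔ x ∈ labelsReg α y ∧
      HasLocalChart α δ y x Literature.Geometry.DiscreteGeometry.hcpKissingPattern := by
  classical
  simp [labelsTcub]

/-- Unfolding `∂X = X ∖ X_Cub`. [cite: FlatleyTheil2015, Definition 3.6] -/
theorem mem_labelsBoundary [DecidableEq X] {α δ : ℝ} {y : X → EuclideanSpace ℝ (Fin 3)} {x : X} :
    x ∈ labelsBoundary α δ y ↔ x ∉ labelsCub α δ y := by
  simp [labelsBoundary]

/-- "Clearly `X ⊇ X₁₂ ⊇ X_reg`." [cite: FlatleyTheil2015, after Definition 3.6] -/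
theorem labelsReg_subset_labelsTwelve (α : ℝ) (y : X → EuclideanSpace ℝ (Fin 3)) :
    labelsReg α y ⊆ labelsTwelve α y :=
  filter_subset _ _

/-- `X_Cub ⊆ X_reg`. [cite: FlatleyTheil2015, Definition 3.6] -/
theorem labelsCub_subset_labelsReg (α δ : ℝ) (y : X → EuclideanSpace ℝ (Fin 3)) :
    labelsCub α δ y ⊆ labelsReg α y := fun _ hx => (mem_labelsCub.1 hx).1

/-- `X_TCub ⊆ X_reg`. [cite: FlatleyTheil2015, Definition 3.6] -/
theorem labelsTcub_subset_labelsReg (α δ : ℝ) (y : X → EuclideanSpace ℝ (Fin 3)) :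
    labelsTcub α δ y ⊆ labelsReg α y := fun _ hx => (mem_labelsTcub.1 hx).1

end LabelClasses

/-! #### The contact graphs of `Cub` and `TCub` are not isomorphic -/

/-- Unit distance in a scaled integer pattern is an integer condition. [folklore] -/
private theorem dist_smul_intVec_eq_one_iff {N : ℕ} (hN : N ≠ 0) (v w : Fin 3 → ℤ) :
    dist ((Real.sqrt N)⁻¹ • Literature.Geometry.DiscreteGeometry.intVec v)
        ((Real.sqrt N)⁻¹ • Literature.Geometry.DiscreteGeometry.intVec w) = 1 ↔
      Literature.Geometry.DiscreteGeometry.sqNormInt (v - w) = N := by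
  have hpos : (0 : ℝ) < Real.sqrt N := by positivity
  rw [dist_eq_norm, ← smul_sub, Literature.Geometry.DiscreteGeometry.intVec_sub, norm_smul,
    norm_inv, Real.norm_of_nonneg hpos.le, Literature.Geometry.DiscreteGeometry.norm_intVec,
    inv_mul_eq_one₀ hpos.ne']
  have h0 : (0 : ℝ) ≤ (Literature.Geometry.DiscreteGeometry.sqNormInt (v - w) : ℝ) := by
    unfold Literature.Geometry.DiscreteGeometry.sqNormInt; positivity
  rw [Real.sqrt_inj (Nat.cast_nonneg _) h0]
  constructor
  · intro h; exact_mod_cast h.symm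
  · intro h; rw [h]; push_cast; rfl

/-- In the cuboctahedron every unit edge has at most one common unit neighbour (integer model,
kernel decision). [folklore] -/
private theorem fccInt_commonNeighbour_unique :
    ∀ v ∈ Literature.Geometry.DiscreteGeometry.fccInt,
      ∀ w ∈ Literature.Geometry.DiscreteGeometry.fccInt,
      Literature.Geometry.DiscreteGeometry.sqNormInt (v - w) = ((2 : ℕ) : ℤ) →
      ∀ c ∈ Literature.Geometry.DiscreteGeometry.fccInt,
      ∀ d ∈ Literature.Geometry.DiscreteGeometry.fccInt,
      Literature.Geometry.DiscreteGeometry.sqNormInt (c - v) = ((2 : ℕ) : ℤ) →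
      Literature.Geometry.DiscreteGeometry.sqNormInt (c - w) = ((2 : ℕ) : ℤ) →
      Literature.Geometry.DiscreteGeometry.sqNormInt (d - v) = ((2 : ℕ) : ℤ) →
      Literature.Geometry.DiscreteGeometry.sqNormInt (d - w) = ((2 : ℕ) : ℤ) → c = d := by
  decide

/-- In `Cub` two adjacent points have at most one common neighbour (unit distances). [folklore] -/
private theorem fccKissingPattern_commonNeighbour_unique {a b c d : EuclideanSpace ℝ (Fin 3)}
    (ha : a ∈ Literature.Geometry.DiscreteGeometry.fccKissingPattern)
    (hb : b ∈ Literature.Geometry.DiscreteGeometry.fccKissingPattern)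
    (hc : c ∈ Literature.Geometry.DiscreteGeometry.fccKissingPattern)
    (hd : d ∈ Literature.Geometry.DiscreteGeometry.fccKissingPattern)
    (hab : dist a b = 1) (hca : dist c a = 1) (hcb : dist c b = 1) (hda : dist d a = 1)
    (hdb : dist d b = 1) : c = d := by
  obtain ⟨v, hv, rfl⟩ := mem_image.1 ha
  obtain ⟨w, hw, rfl⟩ := mem_image.1 hb
  obtain ⟨p, hp, rfl⟩ := mem_image.1 hc
  obtain ⟨q, hq, rfl⟩ := mem_image.1 hd
  rw [dist_smul_intVec_eq_one_iff two_ne_zero] at hab hca hcb hda hdb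
  rw [fccInt_commonNeighbour_unique v hv w hw hab p hp q hq hca hcb hda hdb]

/-- In `TCub` the unit edge `(0,3,−3)/√18, (3,0,−3)/√18` has two common unit neighbours,
`(3,3,0)/√18` and `(−1,−1,−4)/√18`. [folklore] -/
private theorem hcpKissingPattern_two_commonNeighbours :
    ∃ a ∈ Literature.Geometry.DiscreteGeometry.hcpKissingPattern,
      ∃ b ∈ Literature.Geometry.DiscreteGeometry.hcpKissingPattern,
      ∃ c ∈ Literature.Geometry.DiscreteGeometry.hcpKissingPattern,
      ∃ d ∈ Literature.Geometry.DiscreteGeometry.hcpKissingPattern,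
      dist a b = 1 ∧ dist c a = 1 ∧ dist c b = 1 ∧ dist d a = 1 ∧ dist d b = 1 ∧ c ≠ d := by
  have h18 : (18 : ℕ) ≠ 0 := by norm_num
  refine ⟨_, mem_image_of_mem _ (show ![0, 3, -3] ∈ _ by decide),
    _, mem_image_of_mem _ (show ![3, 0, -3] ∈ _ by decide),
    _, mem_image_of_mem _ (show ![3, 3, 0] ∈ _ by decide),
    _, mem_image_of_mem _ (show ![-1, -1, -4] ∈ _ by decide),
    (dist_smul_intVec_eq_one_iff h18 _ _).2 (by decide),
    (dist_smul_intVec_eq_one_iff h18 _ _).2 (by decide),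
    (dist_smul_intVec_eq_one_iff h18 _ _).2 (by decide),
    (dist_smul_intVec_eq_one_iff h18 _ _).2 (by decide),
    (dist_smul_intVec_eq_one_iff h18 _ _).2 (by decide), fun h => ?_⟩
  have := Literature.Geometry.DiscreteGeometry.scaledPattern_map_injective h18 h
  exact absurd this (by decide)

section Partition

variable {X : Type*} [Fintype X]

/-- **`X_Cub ∩ X_TCub = ∅`, pointwise and unconditionally:** no label with `#N(x) ≤ 12` carries
local charts from both patterns (any `α`, any closeness parameters; `h35` not needed). Two charts
would give a unit-distance preserving injection `TCub → Cub`, impossible by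
`fccKissingPattern_commonNeighbour_unique` / `hcpKissingPattern_two_commonNeighbours`.
[cite: FlatleyTheil2015, display after Definition 3.6, p. 10 (second half)] -/
theorem not_hasLocalChart_fcc_hcp {α δ δ' : ℝ} (y : X → EuclideanSpace ℝ (Fin 3)) (x : X)
    (h12 : (univ.filter fun x' => |‖y x' - y x‖ - 1| ≤ α).card ≤ 12)
    (h₁ : HasLocalChart α δ y x Literature.Geometry.DiscreteGeometry.fccKissingPattern)
    (h₂ : HasLocalChart α δ' y x Literature.Geometry.DiscreteGeometry.hcpKissingPattern) :
    False := by
  classical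
  obtain ⟨-, Φ₁, -, -, hN₁, hinj₁, hiff₁, -⟩ := h₁
  obtain ⟨-, Φ₂, -, -, hN₂, hinj₂, hiff₂, -⟩ := h₂
  set Cub := Literature.Geometry.DiscreteGeometry.fccKissingPattern with hCub
  set TCub := Literature.Geometry.DiscreteGeometry.hcpKissingPattern with hTCub
  -- `Φ₁(Cub) = N(x)`
  have himg : Cub.image Φ₁ = univ.filter fun x' => |‖y x' - y x‖ - 1| ≤ α := by
    apply Finset.eq_of_subset_of_card_le
    · intro z hz
      obtain ⟨η, hη, rfl⟩ := mem_image.1 hz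
      exact mem_filter.2 ⟨mem_univ _, hN₁ η hη⟩
    · rw [Finset.card_image_of_injOn (hinj₁.mono (by
          rw [Finset.coe_insert]; exact Set.subset_insert _ _)),
        Literature.Geometry.DiscreteGeometry.card_fccKissingPattern]
      exact h12
  -- pull `TCub` back to `Cub` through the two charts
  have key : ∀ u ∈ TCub, ∃ a ∈ Cub, Φ₁ a = Φ₂ u := by
    intro u hu
    have : Φ₂ u ∈ Cub.image Φ₁ := by rw [himg]; exact mem_filter.2 ⟨mem_univ _, hN₂ u hu⟩
    simpa only [mem_image] using this
  choose f hfmem hfeq using key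
  have hadj : ∀ u (hu : u ∈ TCub) u' (hu' : u' ∈ TCub),
      dist u u' = 1 → dist (f u hu) (f u' hu') = 1 := by
    intro u hu u' hu' h
    have h2 := (hiff₂ u (mem_insert_of_mem hu) u' (mem_insert_of_mem hu')).2 h
    rw [← hfeq u hu, ← hfeq u' hu'] at h2
    exact (hiff₁ _ (mem_insert_of_mem (hfmem u hu)) _ (mem_insert_of_mem (hfmem u' hu'))).1 h2
  have hfinj : ∀ u (hu : u ∈ TCub) u' (hu' : u' ∈ TCub), f u hu = f u' hu' → u = u' := by
    intro u hu u' hu' h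
    have : Φ₂ u = Φ₂ u' := by rw [← hfeq u hu, ← hfeq u' hu', h]
    exact hinj₂ (mem_coe.2 (mem_insert_of_mem hu)) (mem_coe.2 (mem_insert_of_mem hu')) this
  obtain ⟨a, ha, b, hb, c, hc, d, hd, hab, hca, hcb, hda, hdb, hcd⟩ :=
    hcpKissingPattern_two_commonNeighbours
  have := fccKissingPattern_commonNeighbour_unique (hfmem a ha) (hfmem b hb) (hfmem c hc)
    (hfmem d hd) (hadj a ha b hb hab) (hadj c hc a ha hca) (hadj c hc b hb hcb)
    (hadj d hd a ha hda) (hadj d hd b hb hdb)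
  exact hcd (hfinj c hc d hd this)

/-- **`X_Cub ∩ X_TCub = ∅`** for all `α` and all closeness parameters.
[cite: FlatleyTheil2015, display after Definition 3.6, p. 10] -/
theorem disjoint_labelsCub_labelsTcub (α δ δ' : ℝ) (y : X → EuclideanSpace ℝ (Fin 3)) :
    Disjoint (labelsCub α δ y) (labelsTcub α δ' y) := by
  rw [Finset.disjoint_left]
  intro x h₁ h₂
  obtain ⟨hreg, h₁⟩ := mem_labelsCub.1 h₁
  obtain ⟨-, h₂⟩ := mem_labelsTcub.1 h₂
  exact not_hasLocalChart_fcc_hcp y x (mem_labelsReg.1 hreg).1.le h₁ h₂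

/-- **The partition of `X_reg` (modulo Theorem 3.5 = `h35`):** for every `δ > 0` there is
`α₀ > 0` such that for all `α < α₀`, every finite label set `X` and every `y : X → ℝ³` with
(eq:mindist), `X_reg = X_Cub ∪ X_TCub` and `X_Cub ∩ X_TCub = ∅` (label classes of Definition 3.6
with closeness parameter `δ`). The inclusion `⊆` is Proposition 3.3.2 (`exists_localChart_detOne`);
`⊇` is by definition; disjointness is `disjoint_labelsCub_labelsTcub`.
[cite: FlatleyTheil2015, display after Definition 3.6, p. 10] -/
theorem exists_labelsReg_eq_union (h35 : FlatleyEtAl2013_maxContacts) {δ : ℝ} (hδ : 0 < δ) :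
    ∃ α₀ : ℝ, 0 < α₀ ∧ ∀ α : ℝ, α < α₀ →
      ∀ {X : Type*} [Fintype X] [DecidableEq X] (y : X → EuclideanSpace ℝ (Fin 3)),
      (∀ x x', x ≠ x' → 1 - α < ‖y x' - y x‖) →
      labelsReg α y = labelsCub α δ y ∪ labelsTcub α δ y ∧
        labelsCub α δ y ∩ labelsTcub α δ y = ∅ := by
  obtain ⟨α₀, hα₀, h⟩ := exists_localChart_detOne h35 hδ
  refine ⟨α₀, hα₀, fun α hα X _ _ y hsep => ⟨?_, ?_⟩⟩
  · apply Finset.Subset.antisymm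
    · intro x hx
      obtain ⟨h12, h48⟩ := mem_labelsReg.1 hx
      obtain ⟨-, Q, R, Φ, hQ, hdet, hΦ0, hΦN, hinj, hiff, hclose⟩ := h α hα y hsep x h48.ge
      rcases hQ with rfl | rfl
      · exact mem_union_left _ (mem_labelsCub.2 ⟨hx, R, Φ, hdet, hΦ0, hΦN, hinj, hiff, hclose⟩)
      · exact mem_union_right _ (mem_labelsTcub.2 ⟨hx, R, Φ, hdet, hΦ0, hΦN, hinj, hiff, hclose⟩)
    · exact union_subset (labelsCub_subset_labelsReg α δ y) (labelsTcub_subset_labelsReg α δ y)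
  · exact Finset.disjoint_iff_inter_eq_empty.1 (disjoint_labelsCub_labelsTcub α δ δ y)

/-- Hence, for `α < α₀(δ)`: `∂X = X ∖ X_Cub ⊇ X ∖ X_reg` and `X_reg ∖ ∂X = X_Cub`, while the
`TCub`-centred regular labels are boundary labels: `X_TCub ⊆ ∂X` (always).
[cite: FlatleyTheil2015, Definition 3.6] -/
theorem labelsTcub_subset_labelsBoundary [DecidableEq X] (α δ δ' : ℝ) (y : X → EuclideanSpace ℝ (Fin 3)) :
    labelsTcub α δ' y ⊆ labelsBoundary α δ y := by
  intro x hx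
  rw [mem_labelsBoundary]
  exact fun h => Finset.disjoint_left.1 (disjoint_labelsCub_labelsTcub α δ δ' y) h hx

end Partition

#harness_tags exists_card_contactPairs_le_annulus
#harness_tags exists_labelsReg_eq_union
#harness_tags not_hasLocalChart_fcc_hcp
#harness_tags exists_shellCloseTo_of_softContacts
#harness_tags exists_localChart_detOne
#harness_tags exists_localChart
#harness_tags exists_close_pattern_of_contactPairs
#harness_tags exists_card_nbhd_eq_twelve_of_pairs
#harness_tags exists_threeBody_lowerBound
#harness_tags exists_card_nbhdPairs_le

end FlatleyTheil2015

end Literature.MathematicalPhysics.StatisticalMechanics
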